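import Literature.MathematicalPhysics.QuantumFieldTheory.Balaban1983to89.Node00.Record13CoP
import Literature.MathematicalPhysics.QuantumFieldTheory.Balaban1983to89.Node00.Record12BgRowMixed
import Literature.MathematicalPhysics.QuantumFieldTheory.Balaban1983to89.Node00.Record12BgRowTopDomain

/-!
# NODE 00 (YM-PLAN Track A) — RECORD 13, §11 (v1.5 `SepCoP`): ROW P11 ON PRINT'S SEQUENCES, PARTITION-COMPATIBLE RUNS AND PRINT'S (7)-REGULAR DATA, AT
# PRINT'S BACKGROUND OVER PRINT'S TOP DOMAIN `Ω₀` AND WITH PRINT'S `ζ` — keyed on FILE 23 `Node00/Record13CoP.lean` (director-ym LINES №160–№162), AS A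
# SIBLING MODULE

This module IS §11 of RECORD 13 at the v1.5 `CoP` edition (node00-def-T FILE 24T, 2026-08-27): the VERBATIM image of the landed v1.4 = FILE 22T
`Node00/Record13SepCo.lean` (director-ym №149∕№150∕№152: row `bg` on print's sequences `Seq₀`, partition-compatible runs, (7)-regular data, reading the
minimiser of record over print's FULL class (1.7) ∧ (1.9); NO separate (1.9) guard) under KEY-RULE-23's edition token `SepCo ↦ SepCoP` (`₁₃Co ↦ ₁₃CoP`,
`₁₃CCo ↦ ₁₃CCoP`, `stage13Co ↦ stage13CoP` for the FILE 23 names it cites) and the two seeds of FINDING №7's fix (director-ym №160 F7; FILE 23's header):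
the 𝐓-weights `WtOfRecord₁₃P` (12a″ `tkWeightsOfRecordP`, print's `ζ`) and the background `UbgOfRecord₁₃CoP … (n+1) = UbgMSCoPOfRecord …` (node00-def-R FILE
22′ `Node00/LargeFieldBackgroundCoPOfRecord.lean`: FILE 22's class with the scale-0 clauses re-ranged to print's top domain `Ω₀ = Ω₁ + one layer of M₁-cubes`,
[III] p.255, [15] p.277–278 (1)–(3)), and — where FILE 22T's (7)-regular support read the scale-0 data on all of `Ω₁ᶜ` — the re-ranged (7)₀ guard named in
the support's docstring below (node00-def-P11's top-domain twin; print [15] (7): regularity on `𝔅_k`, `Λ₀ ⊆ Ω₀∖Ω₁`).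

NAME CONTINUITY (pub-ymgap-plan COP-ASKS, director-ym №162): `Stage13Params.Provisos₁₃SepCoP` has the SAME fields in the SAME order with the SAME pins as
`Provisos₁₃SepCo` (`toProvisos₁₃Core`, `hM`, `hM₁`, `bg`; faces `.toCore`, `.odd_M`, `.not_four_dvd_M`, `.M₁_dvd_dCubeSide`, `.tstep` verbatim), row `bg`
typed AT `UbgOfRecord₁₃CoP F N θ p n`; the datum ∕ record family `towerOfRecord₁₃SepCoP`, `datumOfRecord₁₃SepCoP`, `isDatumOfRecord₀_datumOfRecord₁₃SepCoP`,
`IsRecordOfRecord₁₃CSepCoP`, `isRecordOfRecord₁₃CSepCoP_at`, `exists_world_isRecordOfRecord₁₃CSepCoP`, `endStatementBPrinted_of_isRecordOfRecord₁₃CSepCoP_of_nodes`,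
… are the images of the 22T names one for one (token table KEY-24T on the cell bus).  HYP-AUDIT: no hypothesis of any imaged statement is dropped,
weakened or added; binder lists verbatim; proofs re-checked, no `sorry`; no instance, no notation; nothing landed is edited.

HONEST FRAMING.  Definitions and verbatim-imaged bookkeeping of record; NOTHING of Bałaban is asserted ([15] Thm 1, (2.27)(iv), hypothesis (B), [V] Thm 1
remain hypotheses ∕ sockets); the node item K0⁗ `Record13SepInhabited` is NOT discharged by this file — pub-ymgap-plan rev 20 re-keys K0–K3 ONCE on the
names below (№160 (3) HOLD-ALL, №162); counts UNMOVED (typed 28∕28 · discharged 5∕28 · R3 0∕3 · Leg 0∕6); one finite 𝕋⁴ programme at fixed ε — NOT the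
continuum ∕ ℝ⁴ ∕ OS ∕ mass-gap ∕ Clay statement.  References: [III] = Balaban1988Convergent, [6] = Balaban1985RegularSpaces, [15] = Balaban1985Variational,
[IV] = Balaban1989LargeFieldI, [V] = Balaban1989LargeFieldII.
-/

noncomputable section

open MeasureTheory
open scoped Matrix.Norms.L2Operator

namespace Literature.MathematicalPhysics.QuantumFieldTheory.Balaban1983to89.Node00

open T4Continuum AveragingRT T4FiniteEpsInhabited FlowStep FlowStepRuns DagBinding T4DatumAssembly
open B12Eq019ActionBody (integrand)

variable (F : T4Family) (N : ℕ) [NeZero N]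

/-! ## §11 (v1.4). ROW P11 ON PRINT'S SEQUENCES, PARTITION-COMPATIBLE RUNS AND PRINT'S (7)-REGULAR DATA, AT THE Co-CLASS BACKGROUND OF RECORD: the support
`suppOfRecord₁₃SepCoP` (membership `⟨regular support, separation, (7)-regularity⟩`), the background `UbgOfRecord₁₃CoP`, the displayed provisos `Provisos₁₃SepCoP`
(successor of `Provisos₁₃SepMixed`: its rows and θ-letters verbatim, `bg` over `suppOfRecord₁₃SepCoP` AT `UbgOfRecord₁₃CoP`, no (1.9) guard), the tower ∕ datum
= FILE 21's Co core ones (`towerOfRecord₁₃CoP ∕ datumOfRecord₁₃CoP` at `h.toCore`) by `rfl`, the reader `norm_E_bg_le_stage13SepCoP`, and the twin face family — every v1.3 statement VERBATIM under KEY-RULE-21 (`SepMixed ↦ SepCo` + the Co tokens) except as listed in the header -/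

section CoRange

/-- **THE SUPPORT OF ROW P11 ON PRINT'S SEQUENCES AND PRINT'S DATA** (v1.4 = v1.3's support WITHOUT the (1.9) guard — director-ym №149 (5): (1.9) is a property of the row's background `UbgOfRecord₁₃CoP`, def-R `coDivClassOn_UbgMSCoPOfRecord`; v1.3: node00-def-P11 LOCATED-P11-MIXED-SUPPORT, director-ym №141∕№142,
dag-lead DEDUP-257, plan g67 ρ1): §9's separated support `suppOfRecord₁₃SepP` CUT DOWN ONCE MORE to the data `W` that are REGULAR IN PRINT'S SENSE
[15] (7) p. 278 — on every plaquette `p′` touching `Λ_{m+1}` the MIXED plaquette variable built with the `V ∕ V̄` rule (bonds off `Λ_{m+1}` carry the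
one-step average of the finer datum) is within `c_R·ε_{m+1}` of `1` (node00-def-P11's `Sect2.DataSmall7P`, the Literature-side twin of print's clause,
on PRINT'S RANGE `Sect2.printedPlaqs` = the level-`j` plaquettes touching `Γ_j` none of whose four bonds has both endpoints in `Ω_{j+1}` — HYP-AUDIT-13
H6 CONCORD node00-def-P11 × dag-ref-G × dag-ref-C: level 0 keeps every all-bonds-pinned plaquette, levels ≥ 1 read `W (m+1)` on `Λ`-bonds and `V̄` on outer
bonds and never a bond inside `Ω_{m+2}`, where print defines nothing; [III] p. 256 «we assume that the field V_{j−1} is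
regular on Γ_{j−1}» read with [15]'s convention).  Membership = `⟨regular support, separation,
(7)-regularity⟩`, in this order.  A SUPPORT GUARD of the same (T1)-shape as v1.2's: a proviso over it demands nothing at data print excludes.
[cite: Balaban1985RegularSpaces, (7) p.278, (1.3)–(1.6) p.77; Balaban1988Convergent, (2.1) p.254, (2.28) p.259] -/
def suppOfRecord₁₃SepCoP (θ : Stage13Params F N) (p : B12.RunParams) (n : ℕ)
    (s : SeqOfRecord F θ.ν θ.τ9.M (gOfRecord₁₃ F N θ p) p.K n) : Set (B15DeterminingSets.MSField (F.P p.K) (SU N)) :=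
  {W | W ∈ suppOfRecord₁₃P F N θ p n s ∧ Sect2.SeqSeparated θ.ν.M₁ s ∧ Sect2.DataSmall7PTop (avOfRecord F N p.K) s.Ω (suppDomOfRecord F θ.ν p.K s.Ω) n (fun j => θ.s2.cR * epsOfRecord θ.ν (gOfRecord₁₃ F N θ p) j) W}

/-- Membership in the separated (7)-regular support, read off (`Iff.rfl`). [cite: Balaban1988Convergent, (2.28) p.259 (bookkeeping)] -/
theorem mem_suppOfRecord₁₃SepCoP_iff (θ : Stage13Params F N) (p : B12.RunParams) (n : ℕ)
    (s : SeqOfRecord F θ.ν θ.τ9.M (gOfRecord₁₃ F N θ p) p.K n) (W : B15DeterminingSets.MSField (F.P p.K) (SU N)) :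
    W ∈ suppOfRecord₁₃SepCoP F N θ p n s ↔
      W ∈ suppOfRecord₁₃P F N θ p n s ∧ Sect2.SeqSeparated θ.ν.M₁ s ∧ Sect2.DataSmall7PTop (avOfRecord F N p.K) s.Ω (suppDomOfRecord F θ.ν p.K s.Ω) n (fun j => θ.s2.cR * epsOfRecord θ.ν (gOfRecord₁₃ F N θ p) j) W :=
  Iff.rfl

/-- The separated (7)-regular support lies in the separated support of v1.2. [cite: Balaban1988Convergent, (2.28) p.259 (bookkeeping)] -/
theorem suppOfRecord₁₃SepCoP_subset_sep (θ : Stage13Params F N) (p : B12.RunParams) (n : ℕ)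
    (s : SeqOfRecord F θ.ν θ.τ9.M (gOfRecord₁₃ F N θ p) p.K n) : suppOfRecord₁₃SepCoP F N θ p n s ⊆ suppOfRecord₁₃SepP F N θ p n s :=
  fun _ hW => ⟨hW.1, hW.2.1⟩

/-- The separated (7)-regular support lies in §2's support of record. [cite: Balaban1988Convergent, (2.28) p.259 (bookkeeping)] -/
theorem suppOfRecord₁₃SepCoP_subset (θ : Stage13Params F N) (p : B12.RunParams) (n : ℕ)
    (s : SeqOfRecord F θ.ν θ.τ9.M (gOfRecord₁₃ F N θ p) p.K n) : suppOfRecord₁₃SepCoP F N θ p n s ⊆ suppOfRecord₁₃P F N θ p n s :=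
  fun _ hW => hW.1

/-- At a NON-separated index the separated (7)-regular support is EMPTY. [cite: Balaban1985RegularSpaces, (1.3)–(1.6) p.77 (bookkeeping)] -/
theorem suppOfRecord₁₃SepCoP_eq_empty_of_not_seqSeparated (θ : Stage13Params F N) (p : B12.RunParams) (n : ℕ)
    {s : SeqOfRecord F θ.ν θ.τ9.M (gOfRecord₁₃ F N θ p) p.K n} (hs : ¬ Sect2.SeqSeparated θ.ν.M₁ s) :
    suppOfRecord₁₃SepCoP F N θ p n s = ∅ :=
  Set.eq_empty_of_forall_notMem fun _ hW => hs hW.2.1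

/-- The TRIVIAL datum `W = 1` lies in the separated (7)-regular support at a separated index, GIVEN its (7)-regularity (displayed).
[cite: Balaban1985RegularSpaces, (7) p.278; Balaban1988Convergent, (2.1) p.254 (bookkeeping)] -/
theorem one_mem_suppOfRecord₁₃SepCoP (θ : Stage13Params F N) (hθ : θ.Pos₁₂ F N) (p : B12.RunParams) (n : ℕ)
    (hε : ∀ j ≤ n, 0 < epsOfRecord θ.ν (gOfRecord₁₃ F N θ p) j)
    {s : SeqOfRecord F θ.ν θ.τ9.M (gOfRecord₁₃ F N θ p) p.K n} (hs : Sect2.SeqSeparated θ.ν.M₁ s)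
    (h7 : Sect2.DataSmall7PTop (avOfRecord F N p.K) s.Ω (suppDomOfRecord F θ.ν p.K s.Ω) n (fun j => θ.s2.cR * epsOfRecord θ.ν (gOfRecord₁₃ F N θ p) j) (1 : B15DeterminingSets.MSField (F.P p.K) (SU N))) :
    (1 : B15DeterminingSets.MSField (F.P p.K) (SU N)) ∈ suppOfRecord₁₃SepCoP F N θ p n s :=
  ⟨one_mem_suppOfRecord₁₃P F N θ hθ p n hε s, hs, h7⟩

variable {F N} in
/-- Transfer: a background proviso granted over §2's WHOLE support holds over the separated (7)-regular one (def-R `BgProvisoΛ.mono`).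
[cite: Balaban1988Convergent, (2.28) p.259 (bookkeeping)] -/
theorem bgProvisoΛ_suppOfRecord₁₃SepCoP_of_suppOfRecord₁₃P {θ : Stage13Params F N} {p : B12.RunParams} {n k : ℕ}
    {U : SeqOfRecord F θ.ν θ.τ9.M (gOfRecord₁₃ F N θ p) p.K n → BgMap F N p.K}
    (h : BgProvisoΛ F N p.K (settingOfRecord₁₃ F N θ p) (θ.Rz p.K) θ.τ9.M k (suppOfRecord₁₃P F N θ p n) U) :
    BgProvisoΛ F N p.K (settingOfRecord₁₃ F N θ p) (θ.Rz p.K) θ.τ9.M k (suppOfRecord₁₃SepCoP F N θ p n) U :=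
  h.mono fun s => suppOfRecord₁₃SepCoP_subset F N θ p n s

variable {F N} in
/-- Transfer: a background proviso granted over v1.2's SEPARATED support holds over the separated (7)-regular one (def-R `BgProvisoΛ.mono`).
[cite: Balaban1988Convergent, (2.28) p.259 (bookkeeping)] -/
theorem bgProvisoΛ_suppOfRecord₁₃SepCoP_of_suppOfRecord₁₃SepP {θ : Stage13Params F N} {p : B12.RunParams} {n k : ℕ}
    {U : SeqOfRecord F θ.ν θ.τ9.M (gOfRecord₁₃ F N θ p) p.K n → BgMap F N p.K}
    (h : BgProvisoΛ F N p.K (settingOfRecord₁₃ F N θ p) (θ.Rz p.K) θ.τ9.M k (suppOfRecord₁₃SepP F N θ p n) U) :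
    BgProvisoΛ F N p.K (settingOfRecord₁₃ F N θ p) (θ.Rz p.K) θ.τ9.M k (suppOfRecord₁₃SepCoP F N θ p n) U :=
  h.mono fun s => suppOfRecord₁₃SepCoP_subset_sep F N θ p n s

/-- **THE DISPLAYED PROVISOS at `θ : Stage13Params`, Stage 13, ROW P11 ON PRINT'S SEQUENCES AND PRINT'S (7)-REGULAR DATA, AT THE Co-CLASS
BACKGROUND OF RECORD** (v1.4 — the successor of v1.3's `Provisos₁₃SepMixed` under director-ym №149 (3)+(5) ∕ №150; v1.2's `Provisos₁₃Sep` and v1.1's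
`Provisos₁₃` before it): the rows of `Provisos₁₃SepMixed` VERBATIM — same field names, same order, the θ-level letters `hM` ([III] p. 245 «M = L^m») and
`hM₁` (H1 «M₁ ∣ M») included — except that row `bg` demands def-R's ranged background proviso `BgProvisoΛ` over the separated (7)-regular support
`suppOfRecord₁₃SepCoP` (membership `⟨regular support, separation, (7)-regularity⟩`; NO (1.9) guard) AT THE Co-CLASS BACKGROUND `UbgOfRecord₁₃CoP` (level
`n+1` = def-R's `UbgMSCoPOfRecord`, the minimiser over print's full class [15] (6) = [6] (1.7) ∧ (1.9), so (1.9) at the background is a property by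
membership, `coDivClassOn_UbgMSCoPOfRecord`) — only at (2.18) indices separated in the sense of [6] (1.3)–(1.6), only at retained (7)-regular data, and only
along runs `(p, n)` in the window whose 𝐃_j-partitions are compatible with the torus (`PartCompat₁₃`; [III] p. 257).  `.toCore` projects to the bg-free
core; there is NO row map from or to `Provisos₁₃ ∕ Provisos₁₃Sep ∕ Provisos₁₃SepMixed` (their `bg` reads §2's carrier `UbgOfRecord₁₃`, a different
object).  Rows `intPiece` ∕ `measω` ∕ `measChi` ∕ `rstep` remain THEOREMS of (H-U) and the ζ-laws (RECORD 13 §4c); the comparability of thresholds and the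
monotonicity of the history are NOT displayed here.  HYPOTHESES, never admissibility clauses, never asserted. [cite: Balaban1988Convergent, (2.1) p.254, (2.7) p.255, p.256, (2.18) p.257, (2.21) p.258, (2.28) p.259, (3.2)–(3.9) pp.265–266, (3.16) p.268, (3.20)–(3.21) p.269; Balaban1985RegularSpaces, (1.3)–(1.9) pp.76–77, (7) p.278; Balaban1985Variational, Thm 1 + (5)–(6) p.20] -/
structure Stage13Params.Provisos₁₃SepCoP (θ : Stage13Params F N) : Prop where
  /-- the level-`k` pieces `χ_k(s)·slot_k(s)` of `ρ_k` are integrable, `k < K`, along the ₁₃ histories -/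
  intPiece : ∀ (p : B12.RunParams) (k : ℕ), k < p.K → ∀ s : SeqOfRecord F θ.ν θ.τ9.M (gOfRecord₁₃ F N θ p) p.K k,
    Integrable (fun U => chiSeqOfRecord F N θ.ν θ.τ9.M (gOfRecord₁₃ F N θ p) p.K k s U *
      slotsOfRecord F N θ.ν θ.τ9 (EOfRecord₁₃ F N θ) (wOfRecord₉ F N θ.toStage9Params) θ.ppSel p
        (gOfRecord₁₃ F N θ p) k s U) (fieldMeasure (F.P p.K) k (SU N))
  /-- (O4): the label weights `ω = a·b·ζ` are jointly measurable in `(V′, U)`, `k < K`, along the ₁₃ histories -/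
  measω : ∀ (p : B12.RunParams) (k : ℕ), k < p.K → ∀ (s : SeqOfRecord F θ.ν θ.τ9.M (gOfRecord₁₃ F N θ p) p.K k)
    (t : LbOfRecord F θ.ν p (gOfRecord₁₃ F N θ p) k),
    Measurable (fun z : GaugeField (F.P p.K) (k + 1) (SU N) × GaugeField (F.P p.K) k (SU N) =>
      ωOfRecord F N θ.ν θ.τ9.M p (gOfRecord₁₃ F N θ p) k θ.A₁ θ.ζ s t z.2 z.1)
  /-- the new front factors `χ_{k+1}(s′)` are measurable, `k < K`, along the ₁₃ histories -/
  measChi : ∀ (p : B12.RunParams) (k : ℕ), k < p.K → ∀ s' : SeqOfRecord F θ.ν θ.τ9.M (gOfRecord₁₃ F N θ p) p.K (k + 1),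
    Measurable (chiSeqOfRecord F N θ.ν θ.τ9.M (gOfRecord₁₃ F N θ p) p.K (k + 1) s')
  /-- the residual `ζ` resolves unity -/
  zetaUnity : IsZetaUnity F N θ.ν θ.τ9.M θ.ζ
  /-- the residual `ζ` has `Σ |ζ| ≤ 1` -/
  zetaAbs : IsZetaAbsLeOne F N θ.ν θ.τ9.M θ.ζ
  /-- def-R's (0.3) provisos of the pre-𝐑 tower of record, INTEGRABLE FORM (`RepData.ProvisosInt`), at every level `k+1 ≤ K`, along the ₁₃ histories, at
  every instance -/
  rstep : ∀ (p : B12.RunParams) (k : ℕ) [DecidableEq (PBond (F.P p.K) (k + 1))], k < p.K →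
    (towerRepOfRecord F N θ.ν θ.τ9 (slotsTOfRecord F N θ.ν θ.τ9 (EOfRecord₁₃ F N θ) (wOfRecord₉ F N θ.toStage9Params) θ.ppSel)
      θ.ppSel p (gOfRecord₁₃ F N θ p) (k + 1)).toRepData.ProvisosInt
  /-- 11c's laws of the residual §2 data -/
  rzLaws : ∀ K, (θ.Rz K).Laws
  /-- 12a's law of the residual part of the 𝐓-weights: `ζ0 ≥ 0` -/
  ztLaws : ∀ K, (θ.Zt K).Laws
  /-- the locality law of the residual 𝐓-weight factor -/
  ztLocal : ∀ K, (θ.Zt K).LocalLaws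
  /-- [III] p. 245 «M = L^m is sufficiently large»: the 𝐑-operation cube side `M` is a POWER OF `L` (θ-level letter of print; tribunal J
  TRIB-J-Q1 2026-08-27: with `Odd L` it excludes `4 ∣ M`, under which `PartCompat₁₃ θ p n` fails for every `n ≥ 1` and row `bg` idles) -/
  hM : ∃ a : ℕ, θ.τ9.M = F.L ^ a
  /-- [III] p. 245 «M₁ = L^{m₁}, M₂ = L^{m₂}, M₁ < M₂ < M» read as the DIVISIBILITY letter H1 of HYP-AUDIT-13 (director-ym №145 (F2)): the layer width `M₁`
  of the (2.13) determining sets divides the 𝐑-cube side `M`, hence every 𝐃_j-cube side `L^j·M·R_j` — so `Ω_j`, `Λ_j ∈ 𝐃_j` are unions of the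
  `M₁L^jη`-blocks of [15] (1) ∕ [6] (1.4) (θ-level, run-free; `M₁_dvd_dCubeSide`) -/
  hM₁ : θ.ν.M₁ ∣ θ.τ9.M
  /-- p. 259, ON PRINT'S RANGES AND PRINT'S SEQUENCES (v1.4): the Co-CLASS background of record
  `UbgOfRecord₁₃CoP` (def-R `UbgMSCoPOfRecord` at the positive levels; director-ym №149 (3)) lies in `U^c_j(X, α_{0,j}, α_{1,j})` for the domains `X ⊂ Λ_j(s)` of the (2.26)–(2.27) ∕ (2.30) sums and in `Ũ^c_j(X)` for the domains of
  the (2.41)(i) range, on the regular retained configurations AT SEPARATED (2.18) indices `s` ([6] (1.3)–(1.6)) — every run whose ₁₃ history stays in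
  the window `]0, γ]` up to the length `n ≤ K` AND whose 𝐃_j-partitions, `1 ≤ j ≤ n`, are compatible with the torus ([III] p. 257; `PartCompat₁₃`, plan WORD-T2) -/
  bg : ∀ (p : B12.RunParams) (n : ℕ), n ≤ p.K → Step.InInterval θ.γ n (gOfRecord₁₃ F N θ p) → PartCompat₁₃ F N θ p n →
    BgProvisoΛ F N p.K (settingOfRecord₁₃ F N θ p) (θ.Rz p.K) θ.τ9.M n (suppOfRecord₁₃SepCoP F N θ p n) (UbgOfRecord₁₃CoP F N θ p n)
  /-- **(H-ζ) ROW** (v1.8 · director-ym №228 LOCATED-ζ · plan g87 S2-FULL): the residual fluctuation factor `ζ` of the record is jointly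
  measurable in the old and new fields — the displayed bookkeeping proviso `ZetaMeasurable` (RECORD 12 measurability), until v1.7 threaded
  as a separate hypothesis `hζ`, now a ROW of every Stage-13 proviso edition.  A REAL, REQUIRED field (readers: `h.zetaMeas`); the `autoParam`
  default below only FILLS it at a construction site that omits it — from a Stage-13 proviso value of ANY edition already in hand (the
  transports ∕ doors) or from an `hζ` in context (the from-scratch selectors) — and fails loudly with the goal displayed otherwise.
  HYPOTHESIS, never an admissibility clause, never asserted. [cite: Balaban1988Convergent, (3.16) p.268, (3.20)–(3.21) p.269 (bookkeeping)] -/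
  zetaMeas : ZetaMeasurable F N θ.ζ := by
    first
      | (have h' := ‹_root_.Literature.MathematicalPhysics.QuantumFieldTheory.Balaban1983to89.Node00.Stage13Params.Provisos₁₃ _ _ _›; exact h'.zetaMeas)
      | (have h' := ‹_root_.Literature.MathematicalPhysics.QuantumFieldTheory.Balaban1983to89.Node00.Stage13Params.Provisos₁₃Core _ _ _›; exact h'.zetaMeas)
      | (have h' := ‹_root_.Literature.MathematicalPhysics.QuantumFieldTheory.Balaban1983to89.Node00.Stage13Params.Provisos₁₃Sep _ _ _›; exact h'.zetaMeas)
      | (have h' := ‹_root_.Literature.MathematicalPhysics.QuantumFieldTheory.Balaban1983to89.Node00.Stage13Params.Provisos₁₃SepCo _ _ _›; exact h'.zetaMeas)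
      | (have h' := ‹_root_.Literature.MathematicalPhysics.QuantumFieldTheory.Balaban1983to89.Node00.Stage13Params.Provisos₁₃SepMixed _ _ _›; exact h'.zetaMeas)
      | (have h' := ‹_root_.Literature.MathematicalPhysics.QuantumFieldTheory.Balaban1983to89.Node00.Stage13Params.Provisos₁₃SepCoP _ _ _›; exact h'.zetaMeas)
      | (have h' := ‹_root_.Literature.MathematicalPhysics.QuantumFieldTheory.Balaban1983to89.Node00.Stage13RParams.Provisos₁₃CoPR _ _ _›; exact h'.zetaMeas)
      | (have h' := ‹_root_.Literature.MathematicalPhysics.QuantumFieldTheory.Balaban1983to89.Node00.Stage13RParams.Provisos₁₃SepCoPR _ _ _›; exact h'.zetaMeas)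
      | (have h' := ‹_root_.Literature.MathematicalPhysics.QuantumFieldTheory.Balaban1983to89.Node00.Stage13HParams.Provisos₁₃CoPH _ _ _›; exact h'.zetaMeas)
      | (have h' := ‹_root_.Literature.MathematicalPhysics.QuantumFieldTheory.Balaban1983to89.Node00.Stage13HParams.Provisos₁₃SepCoPH _ _ _›; exact h'.zetaMeas)
      | assumption

variable {F N}

/-- The separated-range provisos PROJECT to the core (drop `bg`). [cite: Balaban1988Convergent, (2.18) p.257 (bookkeeping)] -/
theorem Stage13Params.Provisos₁₃SepCoP.toCore {θ : Stage13Params F N} (h : θ.Provisos₁₃SepCoP F N) : θ.Provisos₁₃Core F N where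
  intPiece := h.intPiece
  measω := h.measω
  measChi := h.measChi
  zetaUnity := h.zetaUnity
  zetaAbs := h.zetaAbs
  rstep := fun p k _ hk => h.rstep p k hk
  rzLaws := h.rzLaws
  ztLaws := h.ztLaws
  ztLocal := h.ztLocal

/-- (v1.4 pin, as v1.3; tribunal J TRIB-J-Q1 ∕ director-ym №145 (F3)) **`M` IS ODD**: `M = L^a` with `L` odd (`T4Family.hL`).  [cite: Balaban1988Convergent, p.245 (bookkeeping)] -/
theorem Stage13Params.Provisos₁₃SepCoP.odd_M {θ : Stage13Params F N} (h : θ.Provisos₁₃SepCoP F N) : Odd θ.τ9.M := by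
  obtain ⟨a, ha⟩ := h.hM
  rw [ha]
  exact F.hL.1.pow

/-- (v1.4 pin, as v1.3; director-ym №145 (F3)) **THE ANTI-DODGE CERTIFICATE `¬ 4 ∣ M`**: the junk numerics `M := 4` under which `PartCompat₁₃ θ p n` fails for every
`n ≥ 1` (so that row `bg` idles; vet ym-vet-20289, Summits-side `…/Negative/PartCompatDodge.lean`) carry NO v1.3 proviso set — the hypothesis `4 ∣ M` of
that dodge contradicts the field `hM`. [cite: Balaban1988Convergent, p.245, p.257 (bookkeeping)] -/
theorem Stage13Params.Provisos₁₃SepCoP.not_four_dvd_M {θ : Stage13Params F N} (h : θ.Provisos₁₃SepCoP F N) : ¬ 4 ∣ θ.τ9.M := fun h4 =>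
  (Nat.not_even_iff_odd.mpr h.odd_M) (even_iff_two_dvd.mpr (dvd_trans (by norm_num : (2 : ℕ) ∣ 4) h4))

/-- (v1.4 pin, as v1.3; director-ym №145 (F2)) **H1 AT EVERY 𝐃_j-CUBE**: `M₁ ∣ L^j·M·R_j` = `dCubeSide L M R_j j` for every `L`, `R_j`, `j` — the (2.13) layers tile
the 𝐃_j-cubes ([15] (1) ∕ [6] (1.4) «Ω_j a union of M₁L^jη-blocks»). [cite: Balaban1985RegularSpaces, (1) p.277; Balaban1988Convergent, (2.1) p.254, (2.13) p.256 (bookkeeping)] -/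
theorem Stage13Params.Provisos₁₃SepCoP.M₁_dvd_dCubeSide {θ : Stage13Params F N} (h : θ.Provisos₁₃SepCoP F N) (L R j : ℕ) :
    θ.ν.M₁ ∣ dCubeSide L θ.τ9.M R j :=
  (Dvd.dvd.mul_left h.hM₁ (L ^ j)).mul_right R

/-- (v1.4 · SEPARATED (7)-REGULAR RANGE · Co-CLASS BACKGROUND) The weight laws of the run FROM the provisos. [cite: Balaban1988Convergent, (2.21) p.258 (bookkeeping)] -/
theorem Stage13Params.Provisos₁₃SepCoP.wtLaws {θ : Stage13Params F N} (h : θ.Provisos₁₃SepCoP F N) (p : B12.RunParams) : (WtOfRecord₁₃P F N θ p).Laws :=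
  WtOfRecord₁₃P_laws h.ztLaws p

/-- (v1.4 · SEPARATED (7)-REGULAR RANGE · Co-CLASS BACKGROUND) **def-T's step provisos FROM the Stage-13 provisos** at every step `k < K` (as FILE 10's `Provisos₁₀.tstep`, along the ₁₃ histories).
[cite: Balaban1988Convergent, (3.2)–(3.9) pp.265–266, (3.16) p.268, (3.24)–(3.25) p.270] -/
theorem Stage13Params.Provisos₁₃SepCoP.tstep {θ : Stage13Params F N} (h : θ.Provisos₁₃SepCoP F N) (p : B12.RunParams) (k : ℕ) (hk : k < p.K) :
    TStepProvisos F N θ.ν θ.τ9 (EOfRecord₁₃ F N θ) (wOfRecord₉ F N θ.toStage9Params) θ.ppSel p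
      (gOfRecord₁₃ F N θ p) k where
  intPiece := h.intPiece p k hk
  measW := fun s' => measurable_wOfRecord F N θ.ν θ.τ9.M θ.A₁ θ.ζ p (gOfRecord₁₃ F N θ p) k (h.measω p k hk) s'
  absW_le := fun s' U V' => abs_wOfRecord_le_one F N θ.ν θ.τ9.M θ.A₁ h.zetaAbs p (gOfRecord₁₃ F N θ p) k s' U V'
  measChi := h.measChi p k hk
  unity := isStepUnity_wOfRecord F N θ.ν θ.τ9.M θ.A₁ h.zetaUnity p (gOfRecord₁₃ F N θ p) k

/-- (v1.4 · SEPARATED (7)-REGULAR RANGE · Co-CLASS BACKGROUND) **NON-VACUITY OF THE SPACES OF RECORD AT THE RECORD, IN THE WINDOW**, Stage 13 (11c's `Sect2.one_mem_spaceI`; radii by `alphaPos₁₂_of_window`).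
[cite: Balaban1987RG1, (1.11)–(1.16) p.262; Balaban1988Convergent, (2.28) p.259] -/
theorem one_mem_spaceI_stage13SepCoP {θ : Stage13Params F N} (h : θ.Provisos₁₃SepCoP F N) (hθ : θ.Admissible F N) (p : B12.RunParams) (j : ℕ) (Y : Set (Site (F.P p.K) 0))
    (hw : 0 < gOfRecord₁₃ F N θ p j ∧ gOfRecord₁₃ F N θ p j ≤ θ.γ) :
    Sect2.ofBackgroundC (ιSU N) (1 : GaugeField (F.P p.K) 0 (SU N)) ∈
      Sect2.spaceI (settingOfRecord₁₃ F N θ p) (θ.Rz p.K) θ.τ9.M j Y ((lfOfRecord₁₂ F N θ.toStage12Params).alpha0 (gOfRecord₁₃ F N θ p j))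
        ((lfOfRecord₁₂ F N θ.toStage12Params).alpha1 (gOfRecord₁₃ F N θ p j)) :=
  Sect2.one_mem_spaceI (settingOfRecord₁₃ F N θ p) hθ.1.pos.1 (h.rzLaws p.K) θ.τ9.M j Y (alphaPos₁₂_of_window hθ.1 hw.1 hw.2).1
    (alphaPos₁₂_of_window hθ.1 hw.1 hw.2).2

/-- (v1.4 · SEPARATED (7)-REGULAR RANGE · Co-CLASS BACKGROUND) … and in `Ũ^c_j(X, α̃₀, α̃₁)` of record along the sequence's large-field regions, GIVEN positive radii at every level. [cite: Balaban1988Convergent, (2.34)–(2.39) p.261] -/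
theorem one_mem_spaceMS_stage13SepCoP {θ : Stage13Params F N} (h : θ.Provisos₁₃SepCoP F N) (hθ : θ.Admissible F N) (p : B12.RunParams) (j : ℕ) (Y : Set (Site (F.P p.K) 0))
    (Ω : ℕ → Set (Site (F.P p.K) 0))
    (hα : ∀ n, 0 < (lfOfRecord₁₂ F N θ.toStage12Params).alpha0 (gOfRecord₁₃ F N θ p n) ∧ 0 < (lfOfRecord₁₂ F N θ.toStage12Params).alpha1 (gOfRecord₁₃ F N θ p n)) :
    Sect2.ofBackgroundC (ιSU N) (1 : GaugeField (F.P p.K) 0 (SU N)) ∈ Sect2.spaceMS (settingOfRecord₁₃ F N θ p) (θ.Rz p.K) θ.τ9.M j Y Ω :=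
  Sect2.one_mem_spaceMS (settingOfRecord₁₃ F N θ p) (settingOfRecord₁₃_pos F N θ hθ.1.pos p) (h.rzLaws p.K) θ.τ9.M j Y Ω (fun n => (hα n).1) (fun n => (hα n).2)

/-- (v1.4 · SEPARATED (7)-REGULAR RANGE · Co-CLASS BACKGROUND) **ROW `bg` READ OFF ON THE (2.26)–(2.27) RANGE AT THE Co-CLASS BACKGROUND OF RECORD**: in the window,
on a partition-compatible run, at a separated (2.18) index and a retained (7)-regular datum, `U_n(s)(𝐖) ∈ U^c_j(X, α_{0,j}, α_{1,j})` for every `X ∈ 𝐃_j`,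
`X ⊂ Λ_j(s)`, `1 ≤ j ≤ n` (def-R `BgProvisoΛ.mem_spaceI`).  v1.4 issues NO composite reader `norm_E_bg_le_…`: the §2-form law of record (`SLaw₁₃`,
`S218OfRecord₁₃`) is typed at §2's carrier `UbgOfRecord₁₃`, the row at `UbgOfRecord₁₃CoP`; the (2.27)(iv) composition at a v1.4 record is the
(B)-side consumer's, who supplies the form (or an agreement face) AT THIS background — logged, not asserted. [cite: Balaban1988Convergent, (2.26)–(2.28) p.259] -/
theorem bg_mem_spaceI_stage13SepCoP {θ : Stage13Params F N} (h : θ.Provisos₁₃SepCoP F N) (p : B12.RunParams) (n : ℕ) (hn : n ≤ p.K)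
    (hw : Step.InInterval θ.γ n (gOfRecord₁₃ F N θ p)) (hpc : PartCompat₁₃ F N θ p n)
    (s : SeqOfRecord F θ.ν θ.τ9.M (gOfRecord₁₃ F N θ p) p.K n) {W : B15DeterminingSets.MSField (F.P p.K) (SU N)}
    (hW : W ∈ suppOfRecord₁₃SepCoP F N θ p n s) {j : ℕ} (h1 : 1 ≤ j) (hj : j ≤ n) (X : (Sect2.domSys (F.P p.K) θ.τ9.M j).Dom)
    (hX : Sect2.domSites (F.P p.K) θ.τ9.M j X ⊆ s.Λ j) :
    Sect2.ofBackgroundC (ιSU N) (UbgOfRecord₁₃CoP F N θ p n s W) ∈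
      Sect2.spaceI (settingOfRecord₁₃ F N θ p) (θ.Rz p.K) θ.τ9.M j (Sect2.domSites (F.P p.K) θ.τ9.M j X)
        ((lfOfRecord₁₂ F N θ.toStage12Params).alpha0 (gOfRecord₁₃ F N θ p j)) ((lfOfRecord₁₂ F N θ.toStage12Params).alpha1 (gOfRecord₁₃ F N θ p j)) :=
  (h.bg p n hn hw hpc).mem_spaceI s hW h1 hj X hX

/-- (v1.4 · SEPARATED (7)-REGULAR RANGE · Co-CLASS BACKGROUND) **ROW `bg` READ OFF ON THE (2.41)(i) RANGE AT THE Co-CLASS BACKGROUND OF RECORD**: same antecedents,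
`U_n(s)(𝐖) ∈ Ũ^c_j(X)` for every `X ∈ 𝐃_j` meeting `Ω_j(s)` and `Z̃_j(s)` (def-R `BgProvisoΛ.mem_spaceMS`). [cite: Balaban1988Convergent, (2.41)(i) p.261, (2.28) p.259] -/
theorem bg_mem_spaceMS_stage13SepCoP {θ : Stage13Params F N} (h : θ.Provisos₁₃SepCoP F N) (p : B12.RunParams) (n : ℕ) (hn : n ≤ p.K)
    (hw : Step.InInterval θ.γ n (gOfRecord₁₃ F N θ p)) (hpc : PartCompat₁₃ F N θ p n)
    (s : SeqOfRecord F θ.ν θ.τ9.M (gOfRecord₁₃ F N θ p) p.K n) {W : B15DeterminingSets.MSField (F.P p.K) (SU N)}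
    (hW : W ∈ suppOfRecord₁₃SepCoP F N θ p n s) {j : ℕ} (h1 : 1 ≤ j) (hj : j ≤ n) (X : (Sect2.domSys (F.P p.K) θ.τ9.M j).Dom)
    (hX : (Sect2.domSites (F.P p.K) θ.τ9.M j X ∩ s.Ω j).Nonempty ∧
      (Sect2.domSites (F.P p.K) θ.τ9.M j X ∩ Sect2.enlT (F.P p.K) (Sect2.zSide (F.P p.K) θ.ν θ.τ9.M (gOfRecord₁₃ F N θ p) j) 1 (s.Λ j)ᶜ).Nonempty) :
    Sect2.ofBackgroundC (ιSU N) (UbgOfRecord₁₃CoP F N θ p n s W) ∈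
      Sect2.spaceMS (settingOfRecord₁₃ F N θ p) (θ.Rz p.K) θ.τ9.M j (Sect2.domSites (F.P p.K) θ.τ9.M j X) s.Ω :=
  (h.bg p n hn hw hpc).mem_spaceMS s hW h1 hj X hX

/-- (v1.4 · SEPARATED (7)-REGULAR RANGE · Co-CLASS BACKGROUND) **THE (2.27)(iv) BOUND BITES AT THE BACKGROUND OF RECORD**, Stage 13 (v1.1: ON PRINT'S RANGE `X ⊂ Λ_j(s)` — one binder `hX`; v1.2: on print's SEQUENCES and partition-compatible runs — one binder `hpc`): under the provisos, IN THE
WINDOW, whenever `ρ_k` of the run has the repaired §2 form of record (`SLaw₁₃CoP`), its witnessing 𝐄-terms obey `|𝐄^{(j)}(X, U_k(s)(𝐖), z)| ≤ E₀ exp(−κ d_j(X))`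
POINTWISE at every regular retained configuration, for every domain `X ⊂ Λ_j(s)` of the (2.26)–(2.27) sums. [cite: Balaban1988Convergent, (2.23) p.258, (2.26)–(2.28) p.259] -/
theorem norm_E_bg_le_stage13SepCoP {θ : Stage13Params F N} (h : θ.Provisos₁₃SepCoP F N) (p : B12.RunParams) (k : ℕ) (hk : k ≤ p.K)
    (hw : Step.InInterval θ.γ k (gOfRecord₁₃ F N θ p)) (hpc : PartCompat₁₃ F N θ p k) (hS : SLaw₁₃CoP F N θ p k) :
    ∃ t : SeqOfRecord F θ.ν θ.τ9.M (gOfRecord₁₃ F N θ p) p.K k → Sect2.TermValues (F.P p.K) (MatA N) (FluctV N) θ.τ9.M,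
      Sect2.UniversalE t ∧ ∀ s Wc, Wc ∈ suppOfRecord₁₃SepCoP F N θ p k s → ∀ j, 1 ≤ j → j ≤ k →
        ∀ (X : (Sect2.domSys (F.P p.K) θ.τ9.M j).Dom), Sect2.domSites (F.P p.K) θ.τ9.M j X ⊆ s.Λ j →
          ∀ (z : Site (F.P p.K) j) (g' : ℝ), 0 ≤ g' → g' ≤ (lfOfRecord₁₂ F N θ.toStage12Params).γ →
            ‖(t s).E j X z g' (Sect2.ofBackgroundC (ιSU N) (UbgOfRecord₁₃CoP F N θ p k s Wc))‖ ≤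
              (lfOfRecord₁₂ F N θ.toStage12Params).E₀ * Real.exp (-(lfOfRecord₁₂ F N θ.toStage12Params).κ * (Sect2.domSys (F.P p.K) θ.τ9.M j).dj X) :=
  ((sLaw₁₃CoP_iff F N θ p k).mp hS).norm_E_bg_le_Λ (h.bg p k hk hw hpc)

variable (F N)

/-! ### §9b. The tower and the datum of record RE-KEYED on `Provisos₁₃SepCoP`; faces; [V] Thm 1 induction; the record predicate `IsRecordOfRecord₁₃CSepCoP` -/

open Classical in
/-- (v1.4 · SEPARATED (7)-REGULAR RANGE · Co-CLASS BACKGROUND) **THE TOWER OF RECORD at `θ` under its Stage-13 provisos**, BY HAND at the Stage-13 core (`RGMachineCore.Tower`'s five fields): `ρ := densOfRecord₁₃`,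
`Trho := tdensOfRecord₁₃`; the Wilson start by `rhoZero_coreOfRecord₁₃CoP`; the push-forward obligation by def-T's `isRT_trhoOfRecord9` under the step provisos;
(0.4) at the step by `integral_densOfRecord₁₃_succ` under the INTEGRABLE-FORM `rstep` (at the classical instance). [cite: Balaban1988Convergent, (0.2) p.244, (2.18) p.257, (3.25) p.270; Balaban1989LargeFieldI, (0.4) p.176] -/
def towerOfRecord₁₃SepCoP (θ : Stage13Params F N) (h : θ.Provisos₁₃SepCoP F N) : (coreOfRecord₁₃CoP F N θ).Tower (avOfRecord F N) where
  ρ := fun p k => densOfRecord₁₃ F N θ p k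
  Trho := fun p k => tdensOfRecord₁₃ F N θ p k
  rho_zero := fun p => (rhoZero_coreOfRecord₁₃CoP F N θ p).symm
  isRT_Trho := fun p k hk => isRT_trhoOfRecord9 F N θ.ν θ.τ9 (EOfRecord₁₃ F N θ) (wOfRecord₉ F N θ.toStage9Params) θ.ppSel p
    (gOfRecord₁₃ F N θ p) k hk (h.tstep p k hk)
  integral_succ := fun p k hk => integral_densOfRecord₁₃_succ F N θ p k (h.rstep p k hk)

/-- (v1.4 · SEPARATED (7)-REGULAR RANGE · Co-CLASS BACKGROUND) **THE DATUM OF RECORD, STAGE 13**. [cite: Balaban1989LargeFieldII, Thm 1 + (0.1) pp.355–356; Balaban1988Convergent, (0.2) p.244] -/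
def datumOfRecord₁₃SepCoP (θ : Stage13Params F N) (h : θ.Provisos₁₃SepCoP F N) : FiniteEpsData F (SU N) :=
  datumOfTower F N (coreOfRecord₁₃CoP F N θ) (towerOfRecord₁₃SepCoP F N θ h)

/-- BRIDGE (`rfl`, proof irrelevance): the separated-range tower IS the core-keyed tower at `h.toCore`. [cite: Balaban1988Convergent, (0.2) p.244 (bookkeeping)] -/
theorem towerOfRecord₁₃SepCoP_eq_coP (θ : Stage13Params F N) (h : θ.Provisos₁₃SepCoP F N) :
    towerOfRecord₁₃SepCoP F N θ h = towerOfRecord₁₃CoP F N θ h.toCore := rfl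

/-- BRIDGE (`rfl`): the separated-range datum IS the core-keyed datum at `h.toCore`. [cite: Balaban1989LargeFieldII, Thm 1 + (0.1) pp.355–356 (bookkeeping)] -/
theorem datumOfRecord₁₃SepCoP_eq_coP (θ : Stage13Params F N) (h : θ.Provisos₁₃SepCoP F N) :
    datumOfRecord₁₃SepCoP F N θ h = datumOfRecord₁₃CoP F N θ h.toCore := rfl

/-- (v1.4 · SEPARATED (7)-REGULAR RANGE · Co-CLASS BACKGROUND) The tower's densities ARE `densOfRecord₁₃` (`rfl`). [cite: Balaban1988Convergent, (2.18) p.257 (bookkeeping)] -/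
theorem towerOfRecord₁₃SepCoP_ρ (θ : Stage13Params F N) (h : θ.Provisos₁₃SepCoP F N) (p : B12.RunParams) (k : ℕ) :
    (towerOfRecord₁₃SepCoP F N θ h).ρ p k = densOfRecord₁₃ F N θ p k := rfl

/-- (v1.4 · SEPARATED (7)-REGULAR RANGE · Co-CLASS BACKGROUND) The tower's `𝐓ρ_k` ARE `tdensOfRecord₁₃` (`rfl`). [cite: Balaban1988Convergent, (3.25) p.270 (bookkeeping)] -/
theorem towerOfRecord₁₃SepCoP_Trho (θ : Stage13Params F N) (h : θ.Provisos₁₃SepCoP F N) (p : B12.RunParams) (k : ℕ) :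
    (towerOfRecord₁₃SepCoP F N θ h).Trho p k = tdensOfRecord₁₃ F N θ p k := rfl

/-- (v1.4 · SEPARATED (7)-REGULAR RANGE · Co-CLASS BACKGROUND) `ρ₀` of the tower is integrable on every run: `e^{−E(p)}` times the Wilson–Boltzmann weight (`Missing.integrable_boltzmann`). [cite: Balaban1988Convergent, Thm 1 p.262 (bookkeeping)] -/
theorem integrable_towerOfRecord₁₃SepCoP_ρ_zero (θ : Stage13Params F N) (h : θ.Provisos₁₃SepCoP F N) (p : B12.RunParams) :
    Integrable ((towerOfRecord₁₃SepCoP F N θ h).ρ p 0) (fieldMeasure (F.P p.K) 0 (SU N)) := by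
  rw [(towerOfRecord₁₃SepCoP F N θ h).rho_zero p]
  exact (Missing.integrable_boltzmann RegularGaugeGroup.measurable_reTr (F.P p.K) (sq_nonneg _)).const_mul _

open Classical in
/-- (v1.4 · SEPARATED (7)-REGULAR RANGE · Co-CLASS BACKGROUND) `ρ_{k+1}` of the tower is integrable, `k < K`: the (0.3)-density of the R-stepped pre-𝐑 slot under the integrable-form `rstep` (def-R's
`integrable_densityOfSlice_rstepSlotOfRecord_of_provisosInt`). [cite: Balaban1989LargeFieldI, (0.3)–(0.4) p.176 (bookkeeping)] -/
theorem integrable_towerOfRecord₁₃SepCoP_ρ_succ (θ : Stage13Params F N) (h : θ.Provisos₁₃SepCoP F N) (p : B12.RunParams) (k : ℕ) (hk : k < p.K) :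
    Integrable ((towerOfRecord₁₃SepCoP F N θ h).ρ p (k + 1)) (fieldMeasure (F.P p.K) (k + 1) (SU N)) := by
  rw [towerOfRecord₁₃SepCoP_ρ, densOfRecord₁₃_succ]
  exact integrable_densityOfSlice_rstepSlotOfRecord_of_provisosInt F N θ.ν θ.τ9 _ θ.ppSel p _ (k + 1) (h.rstep p k hk)

/-- (v1.4 · SEPARATED (7)-REGULAR RANGE · Co-CLASS BACKGROUND) **THE TOWER OF RECORD IS INTEGRABLE** (`RGMachineCore.Tower.IsIntegrable`): every `ρ_k`, `k ≤ K`, from the displayed provisos alone. [cite: Balaban1988Convergent, (0.2) p.244 (bookkeeping)] -/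
theorem isIntegrable_towerOfRecord₁₃SepCoP (θ : Stage13Params F N) (h : θ.Provisos₁₃SepCoP F N) : (towerOfRecord₁₃SepCoP F N θ h).IsIntegrable
  | p, 0, _ => integrable_towerOfRecord₁₃SepCoP_ρ_zero F N θ h p
  | p, k + 1, hk => integrable_towerOfRecord₁₃SepCoP_ρ_succ F N θ h p k (Nat.lt_of_succ_le hk)

/-- (v1.4 · SEPARATED (7)-REGULAR RANGE · Co-CLASS BACKGROUND) … and every `𝐓ρ_k`, `k < K`, is integrable (def-T's `integrable_piece_trhoOfRecord9` summed). [cite: Balaban1988Convergent, (3.25) p.270 (bookkeeping)] -/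
theorem integrable_towerOfRecord₁₃SepCoP_Trho (θ : Stage13Params F N) (h : θ.Provisos₁₃SepCoP F N) (p : B12.RunParams) (k : ℕ) (hk : k < p.K) :
    Integrable ((towerOfRecord₁₃SepCoP F N θ h).Trho p k) (fieldMeasure (F.P p.K) (k + 1) (SU N)) :=
  integrable_finsetSum Finset.univ (fun s' _ => integrable_piece_trhoOfRecord9 F N θ.ν θ.τ9 (EOfRecord₁₃ F N θ) (wOfRecord₉ F N θ.toStage9Params)
    θ.ppSel p (gOfRecord₁₃ F N θ p) k hk (h.tstep p k hk) s')

/-- (v1.4 · SEPARATED (7)-REGULAR RANGE · Co-CLASS BACKGROUND) FACE `dens` (`rfl`). [cite: Balaban1988Convergent, (2.18) p.257 (bookkeeping)] -/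
theorem dens_datumOfRecord₁₃SepCoP (θ : Stage13Params F N) (h : θ.Provisos₁₃SepCoP F N) (K : ℕ) (g₀ : ℝ) (k : ℕ) :
    (datumOfRecord₁₃SepCoP F N θ h).dens K g₀ k = densOfRecord₁₃ F N θ ⟨K, F.m, g₀⟩ k := rfl

/-- (v1.4 · SEPARATED (7)-REGULAR RANGE · Co-CLASS BACKGROUND) FACE `Trho` (`rfl`). [cite: Balaban1988Convergent, (3.25) p.270 (bookkeeping)] -/
theorem trho_datumOfRecord₁₃SepCoP (θ : Stage13Params F N) (h : θ.Provisos₁₃SepCoP F N) (K : ℕ) (g₀ : ℝ) (k : ℕ) :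
    (datumOfRecord₁₃SepCoP F N θ h).real.Trho K g₀ k = tdensOfRecord₁₃ F N θ ⟨K, F.m, g₀⟩ k := rfl

/-- (v1.4 · SEPARATED (7)-REGULAR RANGE · Co-CLASS BACKGROUND) FACE `𝐑` (`rfl`). [cite: Balaban1989LargeFieldI, (0.2)–(0.3) p.176 (bookkeeping)] -/
theorem R_datumOfRecord₁₃SepCoP_eq_VOfRecord₁₃CoP (θ : Stage13Params F N) (h : θ.Provisos₁₃SepCoP F N) (K : ℕ) (g₀ : ℝ) (k : ℕ) :
    (datumOfRecord₁₃SepCoP F N θ h).real.R K g₀ k = (VOfRecord₁₃CoP F N θ ⟨K, F.m, g₀⟩).R k := rfl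

/-- (v1.4 · SEPARATED (7)-REGULAR RANGE · Co-CLASS BACKGROUND) … and maps `𝐓ρ_k ↦ ρ_{k+1}`. [cite: Balaban1988Convergent, (0.2) p.244; Balaban1989LargeFieldI, (0.3) p.176] -/
theorem R_tdens_datumOfRecord₁₃SepCoP (θ : Stage13Params F N) (h : θ.Provisos₁₃SepCoP F N) (K : ℕ) (g₀ : ℝ) (k : ℕ) :
    (datumOfRecord₁₃SepCoP F N θ h).real.R K g₀ k (tdensOfRecord₁₃ F N θ ⟨K, F.m, g₀⟩ k) =
      densOfRecord₁₃ F N θ ⟨K, F.m, g₀⟩ (k + 1) :=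
  (towerOfRecord₁₃SepCoP F N θ h).inducedR_Trho ⟨K, F.m, g₀⟩ k

/-- (v1.4 · SEPARATED (7)-REGULAR RANGE · Co-CLASS BACKGROUND) FACE construction (`rfl`). [cite: Balaban1989LargeFieldII, Thm 1 + (0.1) pp.355–356 (bookkeeping)] -/
theorem datumOfRecord₁₃SepCoP_C (θ : Stage13Params F N) (h : θ.Provisos₁₃SepCoP F N) :
    (datumOfRecord₁₃SepCoP F N θ h).C = (coreOfRecord₁₃CoP F N θ).construction (densOfRecord₁₃ F N θ) := rfl

/-- (v1.4 · SEPARATED (7)-REGULAR RANGE · Co-CLASS BACKGROUND) FACE β: the datum's β-functions ARE `betaOfRecord₁₃ θ` (`rfl`). [cite: Balaban1987RG1, (1.20)–(1.22) p.264 (bookkeeping)] -/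
theorem βfun_datumOfRecord₁₃SepCoP (θ : Stage13Params F N) (h : θ.Provisos₁₃SepCoP F N) :
    (datumOfRecord₁₃SepCoP F N θ h).βfun = betaOfRecord₁₃ F N θ := rfl

/-- (v1.4 · SEPARATED (7)-REGULAR RANGE · Co-CLASS BACKGROUND) … i.e. the χ-generic β at `T := TcanOfRecord`, `χ := chiFixed29 θ.ν θ.ε₂₉` (`rfl`). [cite: Balaban1987RG1, (1.20)–(1.22) p.264, (2.9) p.266 (bookkeeping)] -/
theorem βfun_datumOfRecord₁₃SepCoP_eq_betaOfRecord₈Tχ (θ : Stage13Params F N) (h : θ.Provisos₁₃SepCoP F N) :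
    (datumOfRecord₁₃SepCoP F N θ h).βfun = betaOfRecord₈Tχ F N (TcanOfRecord F N) (chiFixed29 F N θ.ν θ.ε₂₉) θ.toStage8Params := rfl

/-- (v1.4 · SEPARATED (7)-REGULAR RANGE · Co-CLASS BACKGROUND) FACE flow (`rfl`). [cite: Balaban1987RG1, (0.17)–(0.20) pp.255–256 (bookkeeping)] -/
theorem flow_g_datumOfRecord₁₃SepCoP (θ : Stage13Params F N) (h : θ.Provisos₁₃SepCoP F N) (p : B12.RunParams) :
    ((datumOfRecord₁₃SepCoP F N θ h).C p).flow.g = gOfRecord₁₃ F N θ p := rfl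

/-- (v1.4 · SEPARATED (7)-REGULAR RANGE · Co-CLASS BACKGROUND) FACE av (`rfl`). [cite: Balaban1987RG1, (0.4) p.253 (bookkeeping)] -/
theorem av_datumOfRecord₁₃SepCoP (θ : Stage13Params F N) (h : θ.Provisos₁₃SepCoP F N) : (datumOfRecord₁₃SepCoP F N θ h).av = avOfRecord F N := rfl

/-- (v1.4 · SEPARATED (7)-REGULAR RANGE · Co-CLASS BACKGROUND) STAGE-0 DATUM CLAUSE at the Stage-13 datum (`rfl`). [cite: Balaban1987RG1, (0.3)–(0.4) p.253] -/
theorem isDatumOfRecord₀_datumOfRecord₁₃SepCoP (θ : Stage13Params F N) (h : θ.Provisos₁₃SepCoP F N) : IsDatumOfRecord₀ F N (datumOfRecord₁₃SepCoP F N θ h) := rfl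

/-- (v1.4 · SEPARATED (7)-REGULAR RANGE · Co-CLASS BACKGROUND) BINDER B1 = NODE N23 at the Stage-13 datum. [cite: Balaban1987RG1, (0.4) p.253] -/
theorem isPrintedAveraged_datumOfRecord₁₃SepCoP (θ : Stage13Params F N) (h : θ.Provisos₁₃SepCoP F N) : (datumOfRecord₁₃SepCoP F N θ h).IsPrintedAveraged :=
  isPrintedAveraged_datumOfTower F N _ _

/-- (v1.4 · SEPARATED (7)-REGULAR RANGE · Co-CLASS BACKGROUND) FACE χ ∕ actions ∕ `IndAss` ∕ `Repr`: the Stage-13 core's fields (`rfl`). [cite: Balaban1987RG1, (0.17)–(0.24) pp.255–257 (bookkeeping)] -/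
theorem actionSide_stage13SepCoP (θ : Stage13Params F N) (h : θ.Provisos₁₃SepCoP F N) (p : B12.RunParams) (k : ℕ) :
    ((datumOfRecord₁₃SepCoP F N θ h).C p).χ k = (coreOfRecord₁₃CoP F N θ).χ p k ∧
      ((datumOfRecord₁₃SepCoP F N θ h).C p).effAction k = (coreOfRecord₁₃CoP F N θ).effAction p k ∧
        ((datumOfRecord₁₃SepCoP F N θ h).C p).Ek k = (coreOfRecord₁₃CoP F N θ).Ek p k ∧
          (((datumOfRecord₁₃SepCoP F N θ h).C p).IndAss k ↔ (coreOfRecord₁₃CoP F N θ).IndAss p k) ∧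
            (((datumOfRecord₁₃SepCoP F N θ h).C p).Repr k ↔ (coreOfRecord₁₃CoP F N θ).Repr p k) :=
  ⟨rfl, rfl, rfl, Iff.rfl, Iff.rfl⟩

/-- (v1.4 · SEPARATED (7)-REGULAR RANGE · Co-CLASS BACKGROUND) **FACE `Sect2Form`**: the construction's §2 [III] clause at step `k` IS the repaired §2 form of the post-𝐑 slot family of `ρ_k`, Stage 13.
[cite: Balaban1988Convergent, (2.17)–(2.18) p.257, (2.23)–(2.42) pp.258–261, Thm 1 p.262] -/
theorem sect2Form_stage13SepCoP_iff (θ : Stage13Params F N) (h : θ.Provisos₁₃SepCoP F N) (p : B12.RunParams) (k : ℕ) :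
    ((datumOfRecord₁₃SepCoP F N θ h).C p).Sect2Form k ↔
      HasSect2FormAEZ F N (FluctV N) p.K (settingOfRecord₁₃ F N θ p) (θ.Rz p.K) (WtOfRecord₁₃P F N θ p) k
        (UbgOfRecord₁₃CoP F N θ p k)
        (slotsOfRecord F N θ.ν θ.τ9 (EOfRecord₁₃ F N θ) (wOfRecord₉ F N θ.toStage9Params) θ.ppSel p
          (gOfRecord₁₃ F N θ p) k) :=
  sLaw₁₃CoP_iff F N θ p k

/-- (v1.4 · SEPARATED (7)-REGULAR RANGE · Co-CLASS BACKGROUND) (2.18) holds for the datum's densities with `rep_k` of record, by construction. [cite: Balaban1988Convergent, (2.18) p.257] -/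
theorem holds_dens_datumOfRecord₁₃SepCoP (θ : Stage13Params F N) (h : θ.Provisos₁₃SepCoP F N) (K : ℕ) (g₀ : ℝ) (k : ℕ) :
    (reprOfRecord₁₃ F N θ ⟨K, F.m, g₀⟩ k).Holds ((datumOfRecord₁₃SepCoP F N θ h).dens K g₀ k) :=
  holds_densOfRecord₁₃ F N θ _ k

/-- (v1.4 · SEPARATED (7)-REGULAR RANGE · Co-CLASS BACKGROUND) FACE Wilson start. [cite: Balaban1988Convergent, Thm 1 p.262] -/
theorem dens_zero_datumOfRecord₁₃SepCoP (θ : Stage13Params F N) (h : θ.Provisos₁₃SepCoP F N) (K : ℕ) (g₀ : ℝ) :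
    (datumOfRecord₁₃SepCoP F N θ h).dens K g₀ 0 = rhoZeroOfRecord F N K g₀ (EOfRecord₁₃ F N θ ⟨K, F.m, g₀⟩) :=
  densOfRecord₁₃_zero F N θ ⟨K, F.m, g₀⟩

/-- (v1.4 · SEPARATED (7)-REGULAR RANGE · Co-CLASS BACKGROUND) FACE push-forward: `𝐓ρ_k` IS an averaging-of-record image of `ρ_k` (`k < K`). [cite: Balaban1988Convergent, (3.1) p.264, (3.24)–(3.25) p.270] -/
theorem isRT_trho_datumOfRecord₁₃SepCoP (θ : Stage13Params F N) (h : θ.Provisos₁₃SepCoP F N) (K : ℕ) (g₀ : ℝ) (k : ℕ) (hk : k < K) :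
    IsRT (avOfRecord F N K k).avg ((datumOfRecord₁₃SepCoP F N θ h).dens K g₀ k) ((datumOfRecord₁₃SepCoP F N θ h).real.Trho K g₀ k) :=
  (towerOfRecord₁₃SepCoP F N θ h).isRT_Trho ⟨K, F.m, g₀⟩ k hk

/-- (v1.4 · SEPARATED (7)-REGULAR RANGE · Co-CLASS BACKGROUND) FACE (0.4) at the step: `∫ρ_{k+1} = ∫𝐓ρ_k` (`k < K`). [cite: Balaban1989LargeFieldI, (0.4) p.176] -/
theorem integral_dens_succ_datumOfRecord₁₃SepCoP (θ : Stage13Params F N) (h : θ.Provisos₁₃SepCoP F N) (K : ℕ) (g₀ : ℝ) (k : ℕ) (hk : k < K) :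
    ∫ V, (datumOfRecord₁₃SepCoP F N θ h).dens K g₀ (k + 1) V ∂fieldMeasure (F.P K) (k + 1) (SU N)
      = ∫ V, (datumOfRecord₁₃SepCoP F N θ h).real.Trho K g₀ k V ∂fieldMeasure (F.P K) (k + 1) (SU N) :=
  (towerOfRecord₁₃SepCoP F N θ h).integral_succ ⟨K, F.m, g₀⟩ k hk

/-- (v1.4 · SEPARATED (7)-REGULAR RANGE · Co-CLASS BACKGROUND) `∫ρ_k = ∫ρ₀` along every run, `k ≤ K`. [cite: Balaban1985UV3, (6) p.257] -/
theorem integral_dens_eq_zero_datumOfRecord₁₃SepCoP (θ : Stage13Params F N) (h : θ.Provisos₁₃SepCoP F N) (K : ℕ) (g₀ : ℝ) (k : ℕ) (hk : k ≤ K) :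
    ∫ V, (datumOfRecord₁₃SepCoP F N θ h).dens K g₀ k V ∂fieldMeasure (F.P K) k (SU N)
      = ∫ U, (datumOfRecord₁₃SepCoP F N θ h).dens K g₀ 0 U ∂fieldMeasure (F.P K) 0 (SU N) :=
  (towerOfRecord₁₃SepCoP F N θ h).integral_eq_integral_zero ⟨K, F.m, g₀⟩ k hk

/-- (v1.4 · SEPARATED (7)-REGULAR RANGE · Co-CLASS BACKGROUND) FACE integrability: every density of the datum, `k ≤ K`, is integrable. [cite: Balaban1988Convergent, (0.2) p.244 (bookkeeping)] -/
theorem integrable_dens_datumOfRecord₁₃SepCoP (θ : Stage13Params F N) (h : θ.Provisos₁₃SepCoP F N) (K : ℕ) (g₀ : ℝ) (k : ℕ) (hk : k ≤ K) :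
    Integrable ((datumOfRecord₁₃SepCoP F N θ h).dens K g₀ k) (fieldMeasure (F.P K) k (SU N)) :=
  isIntegrable_towerOfRecord₁₃SepCoP F N θ h ⟨K, F.m, g₀⟩ k hk

/-- (v1.4 · SEPARATED (7)-REGULAR RANGE · Co-CLASS BACKGROUND) … and so is every realised `𝐓ρ_k`, `k < K`. [cite: Balaban1988Convergent, (3.25) p.270 (bookkeeping)] -/
theorem integrable_trho_datumOfRecord₁₃SepCoP (θ : Stage13Params F N) (h : θ.Provisos₁₃SepCoP F N) (K : ℕ) (g₀ : ℝ) (k : ℕ) (hk : k < K) :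
    Integrable ((datumOfRecord₁₃SepCoP F N θ h).real.Trho K g₀ k) (fieldMeasure (F.P K) (k + 1) (SU N)) :=
  integrable_towerOfRecord₁₃SepCoP_Trho F N θ h ⟨K, F.m, g₀⟩ k hk

/-- (v1.4 · SEPARATED (7)-REGULAR RANGE · Co-CLASS BACKGROUND) The T⁴ apex at the Stage-13 datum, B1 eliminated. [cite: JaffeWittenClay2006, §6.5 p.11] -/
theorem continuumYM4Torus_datumOfRecord₁₃SepCoP (θ : Stage13Params F N) (h : θ.Provisos₁₃SepCoP F N)
    (hB : B16.EndStatementBPrinted (datumOfRecord₁₃SepCoP F N θ h).C)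
    (hE : EndpointExistence (datumOfRecord₁₃SepCoP F N θ h).C.toB12)
    (hNE : T4ApexHybrid.HybridNE7Under (datumOfRecord₁₃SepCoP F N θ h) (EndpointExistence (datumOfRecord₁₃SepCoP F N θ h).C.toB12)) :
    T4ContinuumYM4Torus.ContinuumYM4Torus (datumOfRecord₁₃SepCoP F N θ h) :=
  continuumYM4Torus_datumOfTower F N _ _ hB hE hNE

/-- (v1.4 · SEPARATED (7)-REGULAR RANGE · Co-CLASS BACKGROUND) **THE BASE HOLDS** on every run of the Stage-13 datum (`sLaw₁₃CoP_zero`). [cite: Balaban1988Convergent, Thm 1 p.262; Balaban1989LargeFieldII, Thm 1 p.355 (bookkeeping)] -/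
theorem sect2Form_zero_datumOfRecord₁₃SepCoP (θ : Stage13Params F N) (h : θ.Provisos₁₃SepCoP F N) (P : B12.RunParams) :
    ((datumOfRecord₁₃SepCoP F N θ h).C P).Sect2Form 0 :=
  (sect2Form_stage13SepCoP_iff F N θ h P 0).mpr ((sLaw₁₃CoP_iff F N θ P 0).mp (sLaw₁₃CoP_zero F N θ P))

/-- (v1.4 · SEPARATED (7)-REGULAR RANGE · Co-CLASS BACKGROUND) **`B16.InductionBase` AT THE STAGE-13 DATUM, for every window letter `γ`, NO hypothesis.** [cite: Balaban1988Convergent, Thm 1 p.262; Balaban1989LargeFieldII, Thm 1 p.355 + p.391] -/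
theorem inductionBase_datumOfRecord₁₃SepCoP (θ : Stage13Params F N) (h : θ.Provisos₁₃SepCoP F N) (γ : ℝ) : B16.InductionBase (datumOfRecord₁₃SepCoP F N θ h).C γ :=
  fun P _ => sect2Form_zero_datumOfRecord₁₃SepCoP F N θ h P

/-- (v1.4 · SEPARATED (7)-REGULAR RANGE · Co-CLASS BACKGROUND) **THE STEP OF THEOREM 1 AT THE OBJECTS OF RECORD, Stage 13**: along every run in the `γ`-window, from the 𝐓-STEP LAW «`SLaw₁₃CoP k → TLaw₁₃CoP k`» and the 𝐑-LEAF
`ROpLeaf (VOfRecord₁₃CoP θ P)`.  Both hypotheses DISPLAYED. [cite: Balaban1989LargeFieldII, Thm 1 p.355 and pp.390–391; Balaban1988Convergent, Thm p.245, Thm 2 p.263] -/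
theorem inductionStep_datumOfRecord₁₃SepCoP_of_tLaw_rOpLeaf (θ : Stage13Params F N) (h : θ.Provisos₁₃SepCoP F N) (γ : ℝ)
    (hT : ∀ P : B12.RunParams, ((datumOfRecord₁₃SepCoP F N θ h).C P).flow.InInterval γ P.K →
      ∀ k, k < P.K → SLaw₁₃CoP F N θ P k → TLaw₁₃CoP F N θ P k)
    (hR : ∀ P : B12.RunParams, ((datumOfRecord₁₃SepCoP F N θ h).C P).flow.InInterval γ P.K → ROpLeaf (VOfRecord₁₃CoP F N θ P)) :
    B16.InductionStep (datumOfRecord₁₃SepCoP F N θ h).C γ := by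
  intro P hP k hk hS
  have hS' : SLaw₁₃CoP F N θ P k := (sLaw₁₃CoP_iff F N θ P k).mpr ((sect2Form_stage13SepCoP_iff F N θ h P k).mp hS)
  exact (sect2Form_stage13SepCoP_iff F N θ h P (k + 1)).mpr
    ((sLaw₁₃CoP_iff F N θ P (k + 1)).mp ((rOpLeaf_VOfRecord₁₃CoP_iff F N θ P).mp (hR P hP) k hk (hT P hP k hk hS')))

/-- (v1.4 · SEPARATED (7)-REGULAR RANGE · Co-CLASS BACKGROUND) **[V] THEOREM 1 AT THE STAGE-13 DATUM FROM ITS PRINTED PIECES WITHOUT A BASE HYPOTHESIS.** [cite: Balaban1989LargeFieldII, Thm 1 p.355 + p.391; Balaban1988Convergent, Thm 1 p.262, Thm p.245, Thm 2 p.263] -/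
theorem thm1Printed_datumOfRecord₁₃SepCoP_of_tLaw_rOpLeaf (θ : Stage13Params F N) (h : θ.Provisos₁₃SepCoP F N) {γ : ℝ} (hγ : 0 < γ)
    (hT : ∀ P : B12.RunParams, ((datumOfRecord₁₃SepCoP F N θ h).C P).flow.InInterval γ P.K →
      ∀ k, k < P.K → SLaw₁₃CoP F N θ P k → TLaw₁₃CoP F N θ P k)
    (hR : ∀ P : B12.RunParams, ((datumOfRecord₁₃SepCoP F N θ h).C P).flow.InInterval γ P.K → ROpLeaf (VOfRecord₁₃CoP F N θ P)) :
    B16.Thm1Printed (datumOfRecord₁₃SepCoP F N θ h).C :=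
  B16.thm1_of_steps _ γ hγ (inductionBase_datumOfRecord₁₃SepCoP F N θ h γ) (inductionStep_datumOfRecord₁₃SepCoP_of_tLaw_rOpLeaf F N θ h γ hT hR)

/-- (v1.4 · SEPARATED (7)-REGULAR RANGE · Co-CLASS BACKGROUND) **«(D, w) is the record, Stage 13»**: admissible Stage-13 parameters SATISFYING THE STAGE-13 PROVISOS whose Stage-13 datum of record IS `D`, and a world bound
to its construction with a window `0 < w.γ ≤ θ.γ`, Bałaban's block size and the C-binding of record over the Stage-13 view. [cite: Balaban1989LargeFieldII, Thm 1 + (0.1) pp.355–356; Balaban1988Convergent, (0.2) p.244, (2.17)–(2.18) p.257, Thms 1–2 pp.262–263; Balaban1989LargeFieldI, (0.2)–(0.4) p.176; Balaban1987RG1, p.259 (objects of record; bookkeeping)] -/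
def IsRecordOfRecord₁₃CSepCoP (D : FiniteEpsData F (SU N)) (w : WorldP) : Prop :=
  ∃ (θ : Stage13Params F N) (h : θ.Provisos₁₃SepCoP F N), θ.Admissible F N ∧ D = datumOfRecord₁₃SepCoP F N θ h ∧ w.C = D.C ∧ (0 < w.γ ∧ w.γ ≤ θ.γ) ∧
    w.L = (θ.L : ℝ) ∧ ∀ P : B12.RunParams, w.up P = upOfRecord₅C F N (θ.toStage5₁₃CoP F N) P

/-- (v1.4 · SEPARATED (7)-REGULAR RANGE · Co-CLASS BACKGROUND) **Pointed form**. [cite: Balaban1989LargeFieldII, Thm 1 + (0.1) pp.355–356 (bookkeeping)] -/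
theorem isRecordOfRecord₁₃CSepCoP_of_eq (θ : Stage13Params F N) (h : θ.Provisos₁₃SepCoP F N) (hθ : θ.Admissible F N) (w : WorldP)
    (hC : w.C = (datumOfRecord₁₃SepCoP F N θ h).C) (hγ : 0 < w.γ ∧ w.γ ≤ θ.γ) (hL : w.L = (θ.L : ℝ))
    (hup : ∀ P, w.up P = upOfRecord₅C F N (θ.toStage5₁₃CoP F N) P) :
    IsRecordOfRecord₁₃CSepCoP F N (datumOfRecord₁₃SepCoP F N θ h) w :=
  ⟨θ, h, hθ, rfl, hC, hγ, hL, hup⟩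

/-- (v1.4 · SEPARATED (7)-REGULAR RANGE · Co-CLASS BACKGROUND) **Every admissible Stage-12 parameter satisfying the Stage-13 provisos IS a Stage-13 record at some world**, with any window `0 < γw ≤ θ.γ`.
[cite: Balaban1989LargeFieldII, Thm 1 + (0.1) pp.355–356 (bookkeeping)] -/
theorem exists_world_isRecordOfRecord₁₃CSepCoP (θ : Stage13Params F N) (h : θ.Provisos₁₃SepCoP F N) (hθ : θ.Admissible F N) {γw : ℝ} (hγw : 0 < γw ∧ γw ≤ θ.γ) :
    ∃ w : WorldP, IsRecordOfRecord₁₃CSepCoP F N (datumOfRecord₁₃SepCoP F N θ h) w ∧ w.γ = γw := by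
  obtain ⟨w₀⟩ := nonempty_worldP
  exact ⟨{ w₀ with
      C := (datumOfRecord₁₃SepCoP F N θ h).C, γ := γw, L := (θ.L : ℝ), one_lt_L := by exact_mod_cast θ.hL.2,
      up := fun P => upOfRecord₅C F N (θ.toStage5₁₃CoP F N) P },
    ⟨θ, h, hθ, rfl, rfl, hγw, rfl, fun _ => rfl⟩, rfl⟩

variable {F N} in
/-- **EVERY v1.4 RECORD IS A Co CORE RECORD** (along `Provisos₁₃SepCoP.toCore`, same datum by `rfl`; FILE 21's core record family `IsRecordOfRecord₁₃CCoP`) — the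
one-way projection by which every storey keyed ONCE on `Provisos₁₃Core ∕ datumOfRecord₁₃CoP ∕ IsRecordOfRecord₁₃CCoP` serves a v1.4 record.  There is NO
bridge out of the core and NONE from or to the U_old provisos `Provisos₁₃ ∕ Provisos₁₃Sep ∕ Provisos₁₃SepMixed` (their `bg` and datum read `UbgOfRecord₁₃`).
[cite: Balaban1989LargeFieldII, Thm 1 + (0.1) pp.355–356 (bookkeeping)] -/
theorem IsRecordOfRecord₁₃CSepCoP.toCoP {D : FiniteEpsData F (SU N)} {w : WorldP} (h : IsRecordOfRecord₁₃CSepCoP F N D w) :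
    IsRecordOfRecord₁₃CCoP F N D w := by
  obtain ⟨θ, hP, hθ, hD, hC, hγ, hL, hup⟩ := h
  exact ⟨θ, hP.toCore, hθ, hD, hC, hγ, hL, hup⟩

section ConsequencesSepCoP

variable {F N}
variable {D : FiniteEpsData F (SU N)} {w : WorldP}

/-- (v1.4 · SEPARATED (7)-REGULAR RANGE · Co-CLASS BACKGROUND) A Stage-13 record CERTIFIES its parameters' provisos and admissibility. [cite: Balaban1989LargeFieldI, (0.3)–(0.4) p.176 (bookkeeping)] -/
theorem exists_provisos_of_isRecordOfRecord₁₃CSepCoP (h : IsRecordOfRecord₁₃CSepCoP F N D w) :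
    ∃ (θ : Stage13Params F N) (hP : θ.Provisos₁₃SepCoP F N), θ.Admissible F N ∧ D = datumOfRecord₁₃SepCoP F N θ hP := by
  obtain ⟨θ, hP, hθ, hD, -⟩ := h
  exact ⟨θ, hP, hθ, hD⟩

/-- (v1.4 · SEPARATED (7)-REGULAR RANGE · Co-CLASS BACKGROUND) Binding clause 1: the world's construction IS the datum's. [cite: Balaban1989LargeFieldII, Thm 1 p.355 (bookkeeping)] -/
theorem construction_eq_of_isRecordOfRecord₁₃CSepCoP (h : IsRecordOfRecord₁₃CSepCoP F N D w) : w.C = D.C := by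
  obtain ⟨θ, hP, -, -, hC, -⟩ := h
  exact hC

/-- (v1.4 · SEPARATED (7)-REGULAR RANGE · Co-CLASS BACKGROUND) Binding clause 2: the interval constant is positive. [cite: Balaban1989LargeFieldII, Thm 1 p.355 (bookkeeping)] -/
theorem gamma_pos_of_isRecordOfRecord₁₃CSepCoP (h : IsRecordOfRecord₁₃CSepCoP F N D w) : 0 < w.γ := by
  obtain ⟨θ, hP, -, -, -, hγ, -⟩ := h
  exact hγ.1

/-- (v1.4 · SEPARATED (7)-REGULAR RANGE · Co-CLASS BACKGROUND) A Stage-13 record's datum is a datum of record, Stage 0. [cite: Balaban1987RG1, (0.3)–(0.4) p.253 (bookkeeping)] -/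
theorem isDatumOfRecord₀_of_isRecordOfRecord₁₃CSepCoP (h : IsRecordOfRecord₁₃CSepCoP F N D w) : IsDatumOfRecord₀ F N D := by
  obtain ⟨θ, hP, -, rfl, -⟩ := h
  exact isDatumOfRecord₀_datumOfRecord₁₃SepCoP F N θ hP

/-- (v1.4 · SEPARATED (7)-REGULAR RANGE · Co-CLASS BACKGROUND) N23 · binder B1 at every Stage-13 record. [cite: Balaban1987RG1, (0.4) p.253] -/
theorem isPrintedAveraged_of_isRecordOfRecord₁₃CSepCoP (h : IsRecordOfRecord₁₃CSepCoP F N D w) : D.IsPrintedAveraged :=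
  isPrintedAveraged_of_isDatumOfRecord₀ F N D (isDatumOfRecord₀_of_isRecordOfRecord₁₃CSepCoP h)

/-- (v1.4 · SEPARATED (7)-REGULAR RANGE · Co-CLASS BACKGROUND) **A Stage-13 record's 𝐑-leaf IS «repaired 𝐓-image form ⇒ repaired §2 form one level up» along its tower of record**, at every run.
[cite: Balaban1988Convergent, p.244, Thm 2 p.263; Balaban1989LargeFieldII, Thm 1 p.355 (bookkeeping)] -/
theorem exists_rOperation_iff_of_isRecordOfRecord₁₃CSepCoP (h : IsRecordOfRecord₁₃CSepCoP F N D w) :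
    ∃ (θ : Stage13Params F N) (hP : θ.Provisos₁₃SepCoP F N), θ.Admissible F N ∧ D = datumOfRecord₁₃SepCoP F N θ hP ∧
      ∀ P : B12.RunParams, (leavesP w P).rOperation ↔ ∀ k, k < P.K → TLaw₁₃CoP F N θ P k → SLaw₁₃CoP F N θ P (k + 1) := by
  obtain ⟨θ, hP, hθ, hD, -, -, -, hup⟩ := h
  refine ⟨θ, hP, hθ, hD, fun P => ?_⟩
  show (w.up P).rOperation ↔ _
  rw [hup P]
  exact rOperation_upOfRecord₅C_stage13CoP_iff F N θ P

/-- (v1.4 · SEPARATED (7)-REGULAR RANGE · Co-CLASS BACKGROUND) **AT A STAGE-13 RECORD WHOSE 𝐑-LEAVES HOLD, EVERY `ρ_{k+1}` WHOSE `𝐓ρ_k` HAS THE 𝐓-IMAGE FORM HAS THE REPAIRED §2 FORM OF RECORD.**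
[cite: Balaban1988Convergent, Thm 2 p.263, (2.18) p.257, (2.23) p.258 (bookkeeping)] -/
theorem hasSect2FormAEZ_succ_of_isRecordOfRecord₁₃CSepCoP (h : IsRecordOfRecord₁₃CSepCoP F N D w) (hR : ∀ P : B12.RunParams, (leavesP w P).rOperation) :
    ∃ (θ : Stage13Params F N) (hP : θ.Provisos₁₃SepCoP F N), θ.Admissible F N ∧ D = datumOfRecord₁₃SepCoP F N θ hP ∧
      ∀ (P : B12.RunParams) (k : ℕ), k < P.K → TLaw₁₃CoP F N θ P k →
        HasSect2FormAEZ F N (FluctV N) P.K (settingOfRecord₁₃ F N θ P) (θ.Rz P.K) (WtOfRecord₁₃P F N θ P) (k + 1)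
          (UbgOfRecord₁₃CoP F N θ P (k + 1))
          (slotsOfRecord F N θ.ν θ.τ9 (EOfRecord₁₃ F N θ) (wOfRecord₉ F N θ.toStage9Params) θ.ppSel P
            (gOfRecord₁₃ F N θ P) (k + 1)) := by
  obtain ⟨θ, hP, hθ, hD, hrop⟩ := exists_rOperation_iff_of_isRecordOfRecord₁₃CSepCoP h
  exact ⟨θ, hP, hθ, hD, fun P k hk hT => (sLaw₁₃CoP_iff F N θ P (k + 1)).mp (((hrop P).mp (hR P)) k hk hT)⟩

/-- (v1.4 · SEPARATED (7)-REGULAR RANGE · Co-CLASS BACKGROUND) **AT A STAGE-13 RECORD WHOSE 𝐑-LEAVES HOLD, [V] THEOREM 1 FOLLOWS FROM THE 𝐓-STEP LAW ALONE** (any window letter `γ > 0`).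
[cite: Balaban1989LargeFieldII, Thm 1 p.355 + p.391; Balaban1988Convergent, Thm 1 p.262, Thm p.245, Thm 2 p.263 (bookkeeping)] -/
theorem thm1Printed_of_isRecordOfRecord₁₃CSepCoP_of_tLaw (h : IsRecordOfRecord₁₃CSepCoP F N D w) (hR : ∀ P : B12.RunParams, (leavesP w P).rOperation) :
    ∃ (θ : Stage13Params F N) (hP : θ.Provisos₁₃SepCoP F N), θ.Admissible F N ∧ D = datumOfRecord₁₃SepCoP F N θ hP ∧
      ∀ γ : ℝ, 0 < γ → (∀ P : B12.RunParams, (D.C P).flow.InInterval γ P.K → ∀ k, k < P.K → SLaw₁₃CoP F N θ P k → TLaw₁₃CoP F N θ P k) →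
        B16.Thm1Printed D.C := by
  obtain ⟨θ, hP, hθ, hD, hrop⟩ := exists_rOperation_iff_of_isRecordOfRecord₁₃CSepCoP h
  refine ⟨θ, hP, hθ, hD, fun γ hγ hT => ?_⟩
  subst hD
  exact thm1Printed_datumOfRecord₁₃SepCoP_of_tLaw_rOpLeaf F N θ hP hγ hT
    (fun P _ => (rOpLeaf_VOfRecord₁₃CoP_iff F N θ P).mpr ((hrop P).mp (hR P)))

end ConsequencesSepCoP

/-! ### §9c. The shadow RE-KEYED; refinement to the Stage-5 record predicate; transfer of world-reading theorems; β-layer faces -/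

/-- (v1.4 · SEPARATED (7)-REGULAR RANGE · Co-CLASS BACKGROUND) **THE SHADOW RESIDUAL of `θ` under its Stage-13 provisos** (as FILE 12b: `R :=` the induced operation at the Radon–Nikodym image of the tower of record, the
format slot FROZEN at the density of record).  A PROOF DEVICE. [cite: Balaban1989LargeFieldI, (0.2)–(0.4) p.176; Balaban1987RG1, (0.13) p.254 (bookkeeping)] -/
def shadowResidual₁₃SepCoP (θ : Stage13Params F N) (h : θ.Provisos₁₃SepCoP F N) : Residual₅ F N :=
  { residualOfStage13CoP F N θ with
    R := fun p k => (towerOfRecord₁₃SepCoP F N θ h).shadowR p k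
    preservesIntegral_R := fun p k hk => (towerOfRecord₁₃SepCoP F N θ h).preservesIntegral_shadowR p k hk (avOfRecord_measurable F N p.K k)
      (avOfRecord_haarAC F N p.K k hk) (isIntegrable_towerOfRecord₁₃SepCoP F N θ h p k hk.le)
    integrable_R := fun p k hk => (towerOfRecord₁₃SepCoP F N θ h).integrable_shadowR p k
      (isIntegrable_towerOfRecord₁₃SepCoP F N θ h p (k + 1) (Nat.succ_le_of_lt hk))
    S218 := fun p k _ => S218OfRecord₁₃CoP F N θ p k (densOfRecord₁₃ F N θ p k) }

/-- (v1.4 · SEPARATED (7)-REGULAR RANGE · Co-CLASS BACKGROUND) **THE SHADOW Stage-5 parameters of `θ`** at interval letter `γ'`. [cite: Balaban1989LargeFieldI, (0.2) p.176 (bookkeeping)] -/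
def shadow₅OfRecord₁₃SepCoP (θ : Stage13Params F N) (h : θ.Provisos₁₃SepCoP F N) (γ' : ℝ) : Stage5Params F N :=
  { θ.toStage5Params with γ := γ', res := shadowResidual₁₃SepCoP F N θ h }

/-- (v1.4 · SEPARATED (7)-REGULAR RANGE · Co-CLASS BACKGROUND) THE KEY `rfl`: the machine of the shadow has core `coreOfRecord₁₃CoP θ`. [cite: Balaban1988Convergent, (0.2) p.244 (bookkeeping)] -/
theorem toCore_machineOfRecord₅_shadow₁₃SepCoP (θ : Stage13Params F N) (h : θ.Provisos₁₃SepCoP F N) (γ' : ℝ) :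
    (machineOfRecord₅ F N (shadow₅OfRecord₁₃SepCoP F N θ h γ')).toCore = coreOfRecord₁₃CoP F N θ := rfl

/-- (v1.4 · SEPARATED (7)-REGULAR RANGE · Co-CLASS BACKGROUND) The shadow's residual `R` IS the tower's shadow operation (`rfl`). [cite: Balaban1989LargeFieldI, (0.3) p.176 (bookkeeping)] -/
theorem res_R_shadow₁₃SepCoP (θ : Stage13Params F N) (h : θ.Provisos₁₃SepCoP F N) (γ' : ℝ) (p : B12.RunParams) (k : ℕ) :
    (shadow₅OfRecord₁₃SepCoP F N θ h γ').res.R p k = (towerOfRecord₁₃SepCoP F N θ h).shadowR p k := rfl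

/-- (v1.4 · SEPARATED (7)-REGULAR RANGE · Co-CLASS BACKGROUND) The shadow is Stage-5 admissible iff `θ`'s Stage-1 dictionary is admissible and `0 < γ'`. [cite: Balaban1989LargeFieldII, Thm 1 p.355 (bookkeeping)] -/
theorem admissible_shadow₁₃SepCoP (θ : Stage13Params F N) (h : θ.Provisos₁₃SepCoP F N) {γ' : ℝ} (hθ : θ.Admissible F N) (hγ' : 0 < γ') :
    (shadow₅OfRecord₁₃SepCoP F N θ h γ').Admissible :=
  ⟨hθ.1.1.1.1.1.1, hγ'⟩

/-- (v1.4 · SEPARATED (7)-REGULAR RANGE · Co-CLASS BACKGROUND) The shadow's upstream block IS the Stage-13 view's (`rfl`). [cite: Balaban1985UV3, Thm 1 p.257 (bookkeeping)] -/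
theorem upOfRecord₅C_shadow₁₃SepCoP (θ : Stage13Params F N) (h : θ.Provisos₁₃SepCoP F N) (γ' : ℝ) (P : B12.RunParams) :
    upOfRecord₅C F N (shadow₅OfRecord₁₃SepCoP F N θ h γ') P = upOfRecord₅C F N (θ.toStage5₁₃CoP F N) P := rfl

/-- (v1.4 · SEPARATED (7)-REGULAR RANGE · Co-CLASS BACKGROUND) The shadow datum has the SAME CONSTRUCTION as the Stage-13 datum. [cite: Balaban1989LargeFieldII, Thm 1 + (0.1) pp.355–356 (bookkeeping)] -/
theorem datumOfRecord₅_shadow₁₃SepCoP_C (θ : Stage13Params F N) (h : θ.Provisos₁₃SepCoP F N) (γ' : ℝ) :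
    (datumOfRecord₅ F N (shadow₅OfRecord₁₃SepCoP F N θ h γ')).C = (datumOfRecord₁₃SepCoP F N θ h).C :=
  datumOfRecord_C_eq_datumOfTower F N (machineOfRecord₅ F N (shadow₅OfRecord₁₃SepCoP F N θ h γ')) (towerOfRecord₁₃SepCoP F N θ h) (fun _ _ => rfl)

/-- (v1.4 · SEPARATED (7)-REGULAR RANGE · Co-CLASS BACKGROUND) … the same densities. [cite: Balaban1988Convergent, (0.2) p.244 (bookkeeping)] -/
theorem dens_datumOfRecord₅_shadow₁₃SepCoP (θ : Stage13Params F N) (h : θ.Provisos₁₃SepCoP F N) (γ' : ℝ) (K : ℕ) (g₀ : ℝ) (k : ℕ) :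
    (datumOfRecord₅ F N (shadow₅OfRecord₁₃SepCoP F N θ h γ')).dens K g₀ k = (datumOfRecord₁₃SepCoP F N θ h).dens K g₀ k :=
  dens_datumOfRecord_eq_datumOfTower F N (machineOfRecord₅ F N (shadow₅OfRecord₁₃SepCoP F N θ h γ')) (towerOfRecord₁₃SepCoP F N θ h) (fun _ _ => rfl) K g₀ k

/-- (v1.4 · SEPARATED (7)-REGULAR RANGE · Co-CLASS BACKGROUND) … the same β-functions (`rfl`). [cite: Balaban1987RG1, (1.22) p.264 (bookkeeping)] -/
theorem βfun_datumOfRecord₅_shadow₁₃SepCoP (θ : Stage13Params F N) (h : θ.Provisos₁₃SepCoP F N) (γ' : ℝ) :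
    (datumOfRecord₅ F N (shadow₅OfRecord₁₃SepCoP F N θ h γ')).βfun = (datumOfRecord₁₃SepCoP F N θ h).βfun := rfl

/-- (v1.4 · SEPARATED (7)-REGULAR RANGE · Co-CLASS BACKGROUND) … and the same averaging maps (`rfl`). [cite: Balaban1987RG1, (0.4) p.253 (bookkeeping)] -/
theorem av_datumOfRecord₅_shadow₁₃SepCoP (θ : Stage13Params F N) (h : θ.Provisos₁₃SepCoP F N) (γ' : ℝ) :
    (datumOfRecord₅ F N (shadow₅OfRecord₁₃SepCoP F N θ h γ')).av = (datumOfRecord₁₃SepCoP F N θ h).av := rfl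

/-- (v1.4 · SEPARATED (7)-REGULAR RANGE · Co-CLASS BACKGROUND) **A STAGE-13 WORLD IS A STAGE-5 RECORD AT THE SHADOW DATUM**. [cite: Balaban1989LargeFieldII, Thm 1 + (0.1) pp.355–356 (bookkeeping)] -/
theorem isRecordOfRecord₅C_shadow₁₃SepCoP (θ : Stage13Params F N) (h : θ.Provisos₁₃SepCoP F N) (hθ : θ.Admissible F N) (w : WorldP)
    (hC : w.C = (datumOfRecord₁₃SepCoP F N θ h).C) (hγ : 0 < w.γ) (hL : w.L = (θ.L : ℝ))
    (hup : ∀ P, w.up P = upOfRecord₅C F N (θ.toStage5₁₃CoP F N) P) :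
    IsRecordOfRecord₅C F N (datumOfRecord₅ F N (shadow₅OfRecord₁₃SepCoP F N θ h w.γ)) w :=
  isRecordOfRecord₅C_shadow F N (shadow₅OfRecord₁₃SepCoP F N θ h w.γ) (admissible_shadow₁₃SepCoP F N θ h hθ hγ) (towerOfRecord₁₃SepCoP F N θ h)
    (fun _ _ => rfl) w hC rfl hL hup

variable {F N}

/-- (v1.4 · SEPARATED (7)-REGULAR RANGE · Co-CLASS BACKGROUND) **REFINEMENT `IsRecordOfRecord₁₃CSepCoP → IsRecordOfRecord₅C` AT THE SHADOW**: every Stage-13 record's world is a Stage-5 record at a datum with THE SAME construction,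
densities, β-functions and averaging maps. [cite: Balaban1989LargeFieldII, Thm 1 + (0.1) pp.355–356 (bookkeeping)] -/
theorem exists_isRecordOfRecord₅C_of_isRecordOfRecord₁₃CSepCoP {D : FiniteEpsData F (SU N)} {w : WorldP} (h : IsRecordOfRecord₁₃CSepCoP F N D w) :
    ∃ D₅ : FiniteEpsData F (SU N), IsRecordOfRecord₅C F N D₅ w ∧ D₅.C = D.C ∧ (∀ K g₀ k, D₅.dens K g₀ k = D.dens K g₀ k) ∧
      D₅.βfun = D.βfun ∧ D₅.av = D.av := by
  obtain ⟨θ, hP, hθ, rfl, hC, ⟨hγ0, -⟩, hL, hup⟩ := h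
  exact ⟨_, isRecordOfRecord₅C_shadow₁₃SepCoP F N θ hP hθ w hC hγ0 hL hup, datumOfRecord₅_shadow₁₃SepCoP_C F N θ hP w.γ,
    dens_datumOfRecord₅_shadow₁₃SepCoP F N θ hP w.γ, rfl, rfl⟩

/-- (v1.4 · SEPARATED (7)-REGULAR RANGE · Co-CLASS BACKGROUND) **TRANSFER**: every node statement established over the Stage-5 record predicate in the `AtRecord` shape holds at every run of every Stage-13 record's world.
[cite: Balaban1989LargeFieldII, Thm 1 p.355 (bookkeeping)] -/
theorem atWorld_of_isRecordOfRecord₁₃CSepCoP {X : Dag.Leaves → Prop}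
    (h₅ : ∀ (D : FiniteEpsData F (SU N)) (w : WorldP), IsRecordOfRecord₅C F N D w → ∀ P : B12.RunParams, X (leavesP w P))
    {D : FiniteEpsData F (SU N)} {w : WorldP} (h : IsRecordOfRecord₁₃CSepCoP F N D w) (P : B12.RunParams) : X (leavesP w P) := by
  obtain ⟨D₅, h5, -⟩ := exists_isRecordOfRecord₅C_of_isRecordOfRecord₁₃CSepCoP h
  exact h₅ D₅ w h5 P

section TransferredSepCoP

variable {D : FiniteEpsData F (SU N)} {w : WorldP}

/-- (v1.4 · SEPARATED (7)-REGULAR RANGE · Co-CLASS BACKGROUND) Instance · GUARDED (0.20) at every Stage-13 record. [cite: Balaban1987RG1, (0.20) p.256] -/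
theorem rgFlow_of_smallCouplings_of_isRecordOfRecord₁₃CSepCoP (h : IsRecordOfRecord₁₃CSepCoP F N D w) (P : B12.RunParams)
    (hsc : (leavesP w P).smallCouplings) : (leavesP w P).rgFlow := by
  obtain ⟨D₅, h5, -⟩ := exists_isRecordOfRecord₅C_of_isRecordOfRecord₁₃CSepCoP h
  exact rgFlow_of_smallCouplings_of_isRecordOfRecord₅C h5 P hsc

/-- (v1.4 · SEPARATED (7)-REGULAR RANGE · Co-CLASS BACKGROUND) Instance · N01 `Dag.B4_main` at every run of every Stage-13 record. [cite: Balaban1983RegularityDecay, Theorem p.573 (kernel version, transferred)] -/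
theorem b4_main_of_isRecordOfRecord₁₃CSepCoP (h : IsRecordOfRecord₁₃CSepCoP F N D w) (P : B12.RunParams) : Dag.B4_main (leavesP w P) :=
  atWorld_of_isRecordOfRecord₁₃CSepCoP (fun _ _ h5 P => b4_main_of_isRecordOfRecord₅C h5 P) h P

/-- (v1.4 · SEPARATED (7)-REGULAR RANGE · Co-CLASS BACKGROUND) Instance · N02 `Dag.B5_main` at every run of every Stage-13 record. [cite: Balaban1984PropagatorsI, Props. 1.1–1.2 pp.33–36 (kernel versions, transferred)] -/
theorem b5_main_of_isRecordOfRecord₁₃CSepCoP (h : IsRecordOfRecord₁₃CSepCoP F N D w) (P : B12.RunParams) : Dag.B5_main (leavesP w P) :=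
  atWorld_of_isRecordOfRecord₁₃CSepCoP (fun _ _ h5 P => b5_main_of_isRecordOfRecord₅C h5 P) h P

/-- (v1.4 · SEPARATED (7)-REGULAR RANGE · Co-CLASS BACKGROUND) Instance · N04 `Dag.B7_main` at every run of every Stage-13 record. [cite: Balaban1985Averaging, Props. 1–10 pp.26–50 (kernel version, transferred)] -/
theorem b7_main_of_isRecordOfRecord₁₃CSepCoP (h : IsRecordOfRecord₁₃CSepCoP F N D w) (P : B12.RunParams) : Dag.B7_main (leavesP w P) :=
  atWorld_of_isRecordOfRecord₁₃CSepCoP (fun _ _ h5 P => b7_main_of_isRecordOfRecord₅C h5 P) h P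

/-- (v1.4 · SEPARATED (7)-REGULAR RANGE · Co-CLASS BACKGROUND) Instance · the END headline at a Stage-13 record needs NO `rgFlow` binder. [cite: Balaban1989LargeFieldII, Thm 1 p.355 + p.391] -/
theorem endStatementBPrinted_of_isRecordOfRecord₁₃CSepCoP_of_nodes (h : IsRecordOfRecord₁₃CSepCoP F N D w) {γ₀ : ℝ} (hγ₀ : w.γ ≤ γ₀)
    (hnodes : ∀ P, Nodes (leavesP w P)) (hβ : BetaBoundsInInterval w.C.toB12 γ₀ w.b w.βup) :
    B16.EndStatementBPrinted D.C := by
  obtain ⟨D₅, h5, hC5, -⟩ := exists_isRecordOfRecord₅C_of_isRecordOfRecord₁₃CSepCoP h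
  rw [← hC5]
  exact endStatementBPrinted_of_isRecordOfRecord₅C_of_nodes h5 hγ₀ hnodes hβ

end TransferredSepCoP

section BetaLayerSepCoP

variable {D : FiniteEpsData F (SU N)} {w : WorldP}

variable (F N) in
/-- (v1.4 · SEPARATED (7)-REGULAR RANGE · Co-CLASS BACKGROUND) FACE `A_{k+1}`: the core's effective action at step `k+1` IS (0.19)'s `log(𝐍_k⁻¹ · (T_k(χ_k e^{−GF∕g_k²+A_k}))(V))` with `T_k := TcanOfRecord`,
`χ_k := chiFixed29 θ.ν θ.ε₂₉` along the ₁₃ history (`rfl`) — the VALUES this record's β reads: values of a VERSION, canonical by construction, equal to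
print's point values wherever the transform's a.e.-class has a continuous representative near the point (`betaInput_eqOn_of_continuousOn₁₃`) and
nowhere asserted to be print's elsewhere. [cite: Balaban1987RG1, (0.19) p.255, p.259 (bookkeeping)] -/
theorem effAction_succ_stage13SepCoP (θ : Stage13Params F N) (h : θ.Provisos₁₃SepCoP F N) (p : B12.RunParams) (k : ℕ) (V : GaugeField (F.P p.K) (k + 1) (SU N)) :
    ((datumOfRecord₁₃SepCoP F N θ h).C p).effAction (k + 1) V =
      Real.log ((normConstHT F N (TcanOfRecord F N) (chiFixed29 F N θ.ν θ.ε₂₉) p.K (gOfRecord₁₃ F N θ p) k)⁻¹ *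
        TcanOfRecord F N p.K k (integrand (chiFixed29 F N θ.ν θ.ε₂₉ p.K (gOfRecord₁₃ F N θ p) k) (gfOfRecord F N p.K k)
          (gOfRecord₁₃ F N θ p k)
          (effActionHT F N (TcanOfRecord F N) (chiFixed29 F N θ.ν θ.ε₂₉) p.K (gOfRecord₁₃ F N θ p) k)) V) := rfl

/-- (v1.4 · SEPARATED (7)-REGULAR RANGE · Co-CLASS BACKGROUND) **A Stage-13 record's β IS the χ-generic β at the canonical-version transport and the (2.9) species at a positive threshold `ε₂₉`** (elimination face for
β-readers: NODE O, N24, N26). [cite: Balaban1987RG1, (1.20)–(1.22) p.264, (2.9) p.266, (0.13) p.254 (bookkeeping)] -/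
theorem exists_beta_of_isRecordOfRecord₁₃CSepCoP (h : IsRecordOfRecord₁₃CSepCoP F N D w) :
    ∃ (θ : Stage13Params F N) (hP : θ.Provisos₁₃SepCoP F N), θ.Admissible F N ∧ D = datumOfRecord₁₃SepCoP F N θ hP ∧
      D.βfun = betaOfRecord₈Tχ F N (TcanOfRecord F N) (chiFixed29 F N θ.ν θ.ε₂₉) θ.toStage8Params ∧ 0 < θ.ε₂₉ := by
  obtain ⟨θ, hP, hθ, hD, -⟩ := h
  exact ⟨θ, hP, hθ, hD, hD ▸ rfl, hθ.2⟩

end BetaLayerSepCoP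

end CoRange

end Literature.MathematicalPhysics.QuantumFieldTheory.Balaban1983to89.Node00

end
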